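import Mathlib
import HarnessLib
import HarnessLib.Audit
import Summits.QuantumFields.Statement
import HarnessLib.Audit.Status.Attr

/-!
Route: PauliWegnerSea

DORMANT since 2026-08-26T05:05:35Z (reconciler: no traction for 8.4 d (last activity item-evidence-added at 2026-08-17T19:45:08Z); parked, not closed — `ledger route dormant route-QuantumFields-PauliWegnerSea --off` to reactivate) — unstaffed, not closed; items shared with open routes are served there. `ledger route dormant <id> --off` reactivates.

# Route PauliWegnerSea — Pauli is a Wegner estimate — the band-limited Wilson sea (six quark lines
per link) supplies the non-abelian, β-polynomial Wegner input that closes the quark mobility gap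

It suffices to show X = K1 ∧ K2 ∧ K3 ∧ T ∧ D ∧ G′ (card pauli-wegner-band-limited-sea, realised as
an ALTERNATIVE DECOMPOSITION of
the rank-2 crux MobilityGap of route WilsonMobilityGap, whose downstream crux D =
PhaseQuenchedFlavourDecay is re-asked verbatim and shared;
G′ = ChiralGluonicCompletion is the shared G = GluonicCompletion with the regularisation's chirality
at zero added to its hypothesis package —
statement re-type 2026-08-16, p117723; G itself stays attached as the stronger sufficient
statement). K1 (FIBRE COFACTOR DOMINATION, deterministic linear algebra): for
every bare mass m₀ ∈ [−2,2] there are θ₀, C₀ such that on every torus, for every SU(3) background U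
and sites x ≠ y, the
sup over the SU(3)-fibre of the links of star(x) ∪ star(y) of the (x,y) colour–spin block of the
ADJUGATE of the r = 1
Wilson–Dirac matrix is ≤ C₀(1 + n_w(U)) × the sup over the same fibre of |det|, n_w = number of
eigenvalues of γ₅D_W(U) in
(−θ₀, θ₀). K3 (TILTED FLATNESS, harmonic analysis on compact groups): under the two-star conditional
law e^(−βS_W)·Haar the
fermionic weight F = |det ⊕_f D_W(m_f)| (band-limited: bidegree ≤ (6,6) per link per flavour —
Pauli) has sup ≤ C(1+β)^p ×
mean and relative small balls ν(F ≤ ε·mean) ≤ Cε^c, uniformly in the outside field. K2 (FM CLOSURE):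
K1 → K3 → for every
regularisation and positive masses, a ONE-SCALE input (the phase-quenched fractional moment of the
quark propagator on ONE
shell ‖v‖∞ = ℓ₀ ≲ K₀ log(1/a_k)/a_k beats every polynomial in ℓ₀(1+β_k)) implies clause (ii) of
MobilityGap (phase-quenched
fractional-moment decay at a physical rate, uniformly in the volume). T (CHIRAL ONE-SCALE
TRAJECTORY): for N_f = 2, 3 one
mass-independent AF regularisation, CHIRAL AT ZERO (reg.IsChiralAtZero: its honest lattice gap
closes as m → 0⁺, i.e. m_crit(k) is the
chiral line — where the mobility edge of H_W reaches zero), has, for all m > 0, clauses (i), (iii),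
(iv) of MobilityGap and the one-scale input.
Then (i)–(iv) hold, D gives the flavour-charged phase-quenched gap, G′ completes the chiral package
to QCDOf N_f, and QCD = QCDOf 2 ∧ QCDOf 3.
Lean: `FibreCofactorDomination ∧ FMClosureUnquenched ∧ TiltedFlatness ∧ ChiralOneScaleTrajectory ∧
PhaseQuenchedFlavourDecay ∧ ChiralGluonicCompletion`

## Assembly
Pure logic, natively certified (sorry-free deciding theorem `closes` in the planner's glue.lean;
repair of 2026-08-16 after the
statement re-type p117723): QCD = QCDOf 2 ∧ QCDOf 3. For N_f ∈ {2,3}, ChiralOneScaleTrajectory gives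
reg with mass scaling, CHIRALITY AT ZERO,
asymptotic scaling and, for each m > 0, clauses (i), (one-scale), (iii), (iv); FMClosureUnquenched
applied to FibreCofactorDomination,
TiltedFlatness and the one-scale input yields clause (ii), so (i)–(iv) of MobilityGap hold for (reg,
m); PhaseQuenchedFlavourDecay turns (ii)
into the flavour-charged phase-quenched gap; ChiralGluonicCompletion consumes exactly that package —
chirality included — and returns QCDOf N_f.
The clause texts (i)–(iv) and the shared items are byte-identical copies of the gate file of route
WilsonMobilityGap (generated by gen.py in the
opening planner's folder); ChiralOneScaleTrajectory / ChiralGluonicCompletion differ from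
OneScaleTrajectory / GluonicCompletion by the single
conjunct `reg.IsChiralAtZero ∧` inserted after `reg.HasMassScaling ∧`. The legacy `closes` over the
six rev-0 items still elaborates
(GluonicCompletion concludes QCDOf N_f by name) and is kept verbatim in the file so that
Theorems/PauliWegnerSeaAssembly.lean (item Assembly,
proved) keeps compiling.

Rationale: WHY THIS LINE. Route WilsonMobilityGap names its own rank-2 failure mode: "no Wegner/FM input exists
for non-abelian Haar links entering
H_W non-monotonically; link conditionals sharpen ~e^(cβ_k)". The card's observation is that Pauli
exclusion IS that input:
the r = 1 hop blocks −½(1∓γ_μ)⊗U are rank 6, so det D_W is band-limited of bidegree ≤ (6,6) in every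
link (KnechtliHasenfratz
doi:10.1103/physrevd.63.114502 in algorithmic dress; Rossi–Wolff at β = 0), and band-limited
functions on a compact group obey
TYPE-controlled inequalities — Nikolskii, Remez/Turán–Nazarov small balls, Carbery–Wright under
log-concave-cored laws
(doi:10.4310/mrl.2001.v8.n3.a1, doi:10.1070/im1973v007n02abeh001941, doi:10.1007/978-1-4612-0793-1)
— whose constants
depend on the degree 6N_f and never on β, κ, the background or the volume. Imported area:
polynomial-structure Wegner
substitutes of random-operator theory (Bourgain–Goldstein Cartan estimates doi:10.2307/2661356,
Elgart–Shamis–Sodin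
ratio-of-polynomials fractional moments doi:10.4171/jems/451, finite-volume fractional-moment
criteria AizenmanEtAl2001)
transplanted to GAUGE FIBRES with the explicit dictionary single-site variable ↦ the 16 links of two
stars, Möbius lemma ↦
two-star Schur complement, absolute s-regularity ↦ relative (scaling-covariant, hence β-polynomial)
small balls, ESS's
(V(y)−λ)-cancellation ↦ the deterministic crux K1 forced by γ₅-hermiticity (every pole of G =
adj/det carries the same
H_W-eigenvector at both ends, and the sea cancels its own poles). New relative to every existing QCD
route: all fermionic
controls in the 25 Theses files are spectral/norm/position-space (hopping, Schur dissection,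
chessboard, heat kernel,
diamagnetism); none uses the Peter–Weyl degree of the sea, and the negatives index (two
MultibosonBridge root-ladder
refutations, one diagonal-mirror RP refutation) is not touched.

RANKED CRUXES. #2 FibreCofactorDomination (crux) — card K1, the deterministic two-star crux. For
every bare mass m₀ ∈ [−2,2] there are a window θ₀ > 0 and C₀ > 0 such that on every torus (ℤ/L)⁴
with L ≥ 4, for every SU(3) background U and every pair of sites x ≠ y: writing refit(W) for U with
the links of star(x) ∪ star(y) (e.1 = x,y or e.1+ê.2 = x,y) replaced by those of W, D(V) =
wilsonDirac (fundamental SU(3)) V m₀ 1 and n_w = #{roots of the characteristic polynomial of γ₅D(U)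
with |Re| < θ₀} (in-window modes of the Hermitian Wilson–Dirac operator), for every W there is W′
with Σ_{a,i,b,j} ‖adj(D(refit W))_{(x,a,i),(y,b,j)}‖ ≤ C₀ (1 + n_w) ‖det D(refit W′)‖ — i.e.
sup_fibre ‖adj_xy‖ ≤ C₀(1+n_w) sup_fibre |det|. γ₅-hermiticity makes two stars suffice (adj = det·G
is pole-free and every pole of G carries the same H_W-eigenvector at both ends); one far star
provably does not (tail ratio e^(M|x−y|), kit j002311 of the card). [difficulty: L] (why it might
fail: Hybridised clusters of near-real modes cored BETWEEN x and y, or a W-independent near-null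
structure of the two-star Schur complement, could keep det small on the whole fibre while adj_xy is
not: C super-linear in n_w, or even C(L) = ∞ (common zeros of both suprema).) [doi:10.4171/jems/451,
AizenmanEtAl2001, AizenmanMolchanov1993, doi:10.1103/physrevd.63.114502, arXiv:hep-lat/0203026,
GoltermanShamir2003, MontvayMunster1994]
#3 TiltedFlatness (crux, PROVED — Theorems `CircleTransport.TiltedFlatness_proof`; rev-4 text,
restated after the conditional refutation `PauliWegnerSeaTiltedFlatness_refuted` of the rev-3
β-uniform clause (b)) — card K3, Laplace–Remez on the two-star fibre with a POLYNOMIAL LOSS IN BOTH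
CLAUSES: ∀ N_f ∃ C, p, c > 0: for every β ≥ 0, masses in [−2,2]^N_f, torus L ≥ 4, outside U and
sites x, y, the weight F(W) = |det diracMatrix(refit W)| (bidegree ≤ (6N_f,6N_f) per star link)
under the star-conditional law wt = e^(−β S_W(refit W))·Haar with mean M obeys (a) F(W₀) ≤ C(1+β)^p
M and (b′) M > 0 ⇒ ν(F ≤ εM) ≤ C(1+β)^p ε^c. [difficulty: M] (why it might fail: settled — proved in
tree.) [CarberyWright2001, Brudnyi1999, doi:10.1070/im1973v007n02abeh001941,
doi:10.1512/iumj.1995.44.1980, arXiv:math/0108212]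
#4 FMClosureUnquenched (crux) — card K2, the fractional-moment bootstrap in the unquenched gauge
setting. FibreCofactorDomination → TiltedFlatness → for every N_f, every reg : QCDRegularisation N_f
and every mass tuple m > 0: IF (one-scale input) for every q there are K₀ and s ∈ (0,1) such that
for all large k some shell radius ℓ₀ ∈ [1, L_k] with ℓ₀ a_k ≤ K₀(1+|log a_k|) has ℓ₀^q (1+|β_k|)^q ·
E_{|w|,k,S}[(Σ_{colour,spin}|G_f(0,v)|)^s] ≤ 1 for all S ≥ L_k, all flavours f and all v with ‖v‖∞ =
ℓ₀ (E_{|w|,k,S} = Wilson measure at β_k on the torus of side 2S+1 reweighted by |det diracMatrix| at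
the bare masses m_f(k) = m_crit(k) + a_k m_f/Z_m(k), G = diracMatrix⁻¹ — verbatim the quantity of
MobilityGap (ii)), THEN clause (ii) of WilsonMobilityGap.MobilityGap holds for (reg, m): ∃ s, δ, C
with E_{|w|,k,S}[(Σ|G_f(0,v)|)^s] ≤ C e^(−δ a_k ‖v‖) for all large k, S ≥ L_k, v ∈ box S. The
finite-volume criterion of Aizenman–Schenker–Friedrich–Hundertmark with the a-priori bound and the
decoupling lemma supplied by K1 + K3 (fibrewise reverse Hölder under the star-conditional law)
instead of rank-one Möbius averaging over an i.i.d. potential; the logs cancel: smallness a_k^(sK₀m)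
won at ℓ₀ ~ K₀ log(1/a_k)/a_k returns the physical rate δ ~ m(s − q/K₀m). [deps:
FibreCofactorDomination, TiltedFlatness] [difficulty: L] (why it might fail: Links are correlated,
not i.i.d.: decoupling needs K1/K3 conditionally on far events with boundary factors summable
against ℓ₀^q(1+β_k)^q, and with s < 1 the lattice-unit shell entropy a_k^(−3(1−s)) must be re-won at
EVERY scale of the bootstrap, not only the first.) [AizenmanEtAl2001, AizenmanMolchanov1993,
doi:10.4171/jems/451, AizenmanWarzel2015, GoltermanShamir2003]
#5 ChiralOneScaleTrajectory (crux) — the consumer's half AFTER THE STATEMENT RE-TYPE of 2026-08-16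
(p117723: `QCDOf` gained `reg.IsChiralAtZero`): the clauses (i), (one-scale), (iii), (iv) of
OneScaleTrajectory (#9 below, stmt-QuantumFields-11513, verbatim) for ONE reg : QCDRegularisation
N_f (N_f ∈ {2,3}) with HasMassScaling, two-loop asymptotic scaling AND `reg.IsChiralAtZero` — for
every ε > 0 some positive mass tuple m has ¬(reg.scheme m 0 0).HasLatticeMassGap ε: the honest
signed lattice gap closes as m → 0⁺, which pins the flavour-blind offset of m_crit(k) to the chiral
point (the up-shift symmetry behind `qcdOf_iff_threshold` is gone). The conjunct rides INSIDE the ∃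
and cannot be a separate ∀-reg item: the package for all m > 0 is invariant under up-shifts m_crit ↦
m_crit + a_k M₀/Z_m (m ↦ m + M₀), chirality is not, so 'package ⇒ chiral' for every reg would
contradict the gap above the shift. In this route's dictionary (Golterman–Shamir) the constructor
must put m_crit(k) where the mobility edge of H_W = γ₅D_W reaches zero — the Aoki/chiral boundary at
β_k — and exhibit a pion-channel connected correlator of the HONEST theory decaying slower than any
fixed physical rate as m → 0⁺ (Goldstone, m_π² ∝ m: a volume-uniform LOWER bound on a signed
correlator, new to the item). Implies #9 by forgetting the conjunct (planner Sketch, rc0), so all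
evidence on stmt-11513 transfers (Cruxes/OneScaleTrajectory/: Disproof.lean tightness lemmas — log
room both ways, ℓ₀ ≥ 1, (iv) free at positive bare masses, (iii) ⇒ limsup m_crit ≤ 0; dead lines
threshold-tuned-witness at stub_lowerPin and adjugate-anticoncentration-pin at
stub_harmonicTrajectory; lead c2's Restatement-c2.md R1–R4 — tenure business, not applied here).
[deps: FMClosureUnquenched] [difficulty: open-problem] (why it might fail: Adds Goldstone
gaplessness of the SIGNED theory as m→0⁺ at the witness's own m_crit(k): a volume-uniform lower
bound on a pion correlator (none in tree; (−1)^F-periodic typing) on top of 11513's open (iii)/(iv);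
false if localisation at physical rate holds only strictly above the chiral line.)
[GoltermanShamir2003, SharpeSingleton1998, EdwardsHellerNarayanan1998, Luscher1977,
MontvayMunster1994, JaffeWitten2000, arXiv:hep-lat/9808010]
#6 PhaseQuenchedFlavourDecay (crux) — SHARED verbatim with route WilsonMobilityGap
(stmt-QuantumFields-9151, its card K2): for every N_f, reg, m > 0, clause (ii) (phase-quenched
fractional-moment decay of the quark propagator) alone implies a phase-quenched Euclidean-time gap
at a physical rate, uniformly in the volume, for every FLAVOUR-CHARGED gauge-invariant local lattice
observable against any other (Wick's theorem in determinant form: complementary minors of the D_f;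
flavour charge forces ≥ |q| quark lines across the separation). Re-asked here so the item attaches
to both routes; this route adds that the band limit covers minors too (r×r minors of D_W are
band-limited of the same type), which is the natural tool for its first-moment upgrade. [deps:
FMClosureUnquenched, OneScaleTrajectory] [difficulty: L] (why it might fail: (ii) gives s<1
single-entry moments; the conclusion needs, even at n=0, volume-uniform FIRST moments of r×r minors
of G_f (r≥2: baryons) under the non-product |Πdet| weight: a Minami-type bound (known for rank-one
site disorder only) plus an eigenfunction-correlator step via independent disorder.)
[Weingarten1983, VafaWitten1984NPB, SimsWarzel2016, AizenmanWarzel2015, Minami1996,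
MontvayMunster1994]
#7 GluonicCompletion (crux) — SHARED verbatim with route WilsonMobilityGap (stmt-QuantumFields-9152,
its card K3 + UV; the Yang–Mills-hard remainder common to every QCD route): for N_f ∈ {2,3}, a
regularisation with HasMassScaling, asymptotic scaling and, for every m > 0, clauses (i)–(iv)
together with the flavour-charged phase-quenched gap can be completed to QCDOf N_f (signed weight by
sign-defect reweighting, flavour-neutral and gluonic channels, continuum limit with E0–E4,
non-triviality, full HasLatticeMassGap). After the re-type this shared item concludes the NEW QCDOf
by name, i.e. silently 'complete to a chiral-at-zero witness' — stronger than its package supports;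
the deciding theorem now rests on #8 (which it implies in one line) but the item stays attached:
shared by signature with WilsonMobilityGap and cited by name in
Cruxes/GluonicCompletion/{Disproof.lean, Lines/…} and
Theorems/PauliWegnerSeaGluonicCompletionOfThresholdQCD.lean. [deps: OneScaleTrajectory,
PhaseQuenchedFlavourDecay] [difficulty: open-problem] (why it might fail: Contains the YM gap: sign
coherence comes only at side 2L_k+1 but HasLatticeMassGap needs all S≥L_k, where
⟨σ⟩_|w|~exp(−c(a_kS)^4)→0, so signed ratios need a convergent sign-defect polymer expansion =
uniform gluonic clustering at weak coupling (open); plus E0–E4, rotations, non-Gaussian glue.)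
[JaffeWitten2000, Balaban1988Convergent, OsterwalderSeiler1978, Luscher1977, MohlerSchaefer2020,
SeilerLNP1982]
#8 ChiralGluonicCompletion (crux) — the completion AFTER THE RE-TYPE: GluonicCompletion (#7,
stmt-QuantumFields-9152) with `reg.IsChiralAtZero` INSERTED INTO THE HYPOTHESIS package right after
`reg.HasMassScaling` (mirroring the new QCDOf; otherwise byte-identical, so WilsonMobilityGap's
repair can re-ask it verbatim and share it). For N_f ∈ {2,3}: a reg with HasMassScaling,
IsChiralAtZero, asymptotic scaling and, for every m > 0, clauses (i)–(iv) plus the flavour-charged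
phase-quenched gap ⇒ QCDOf N_f. The completion now keeps the GIVEN critical line (an up-shift kills
chirality, a down-shift leaves the package's domain) and supplies, at the same bare data for every m
> 0, the signed weight (sign-defect reweighting from (iv)), flavour-neutral and gluonic channels,
the continuum limit with E0–E4, non-triviality, non-Gaussian glue, non-decoupling and the FULL
HasLatticeMassGap; the conclusion's chirality is the hypothesis's. #7 ⇒ #8 (planner Sketch, rc0).
The three leads' verdict on 9152 (BLOCKED-ON ThresholdQCD stmt-QuantumFields-8794 via the transfer
p88912 over `qcdOf_iff_threshold`.2) is void as typed — the ← half of the threshold reading is false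
after the re-type — and re-targets here as 'blocked on ThresholdQCD at the chiral line'; everything
landed under 9152 (cutoff window, quark locality, diagonal subsequence, p81466 a.e. det ≠ 0, p90819
sign budget, p80173) supports #8 unchanged. [deps: ChiralOneScaleTrajectory,
PhaseQuenchedFlavourDecay] [difficulty: open-problem] (why it might fail: Contains the YM gap
exactly as 9152: sign coherence only at side 2L_k+1 while HasLatticeMassGap needs all S ≥ L_k
(⟨σ⟩_|w| ~ exp(−c(a_kS)^4) → 0) ⇒ convergent sign-defect expansion = uniform gluonic clustering at
weak coupling, open; plus E0–E4, non-Gaussian glue. Chirality is given, not produced.)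
[JaffeWitten2000, Balaban1988Convergent, OsterwalderSeiler1978, Luscher1977, MohlerSchaefer2020,
SeilerLNP1982]
#9 OneScaleTrajectory (support; was crux #5 until the re-type repair of 2026-08-16) —
stmt-QuantumFields-11513: ∃ reg with HasMassScaling, asymptotic scaling and, ∀ m > 0, (i) −1 <
m_f(k) eventually; (one-scale) ∀q ∃K₀, s ∈ (0,1), eventually some shell ℓ₀ ≤ L_k, ℓ₀a_k ≤ K₀(1+|log
a_k|) with ℓ₀^q(1+|β_k|)^q E_{|w|,k,S}[(Σ|G_f(0,v)|)^s] ≤ 1 ∀ S ≥ L_k, ‖v‖∞ = ℓ₀; (iii) c₀e^(−C₁a_kn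
− p log(n+1)) ≤ E_{|w|,k,S}[(Σ|G_f(0,ne₀)|)^s]; (iv) ½ ≤ |∫det|/∫|det| at side 2L_k+1. Implied by #5
and no longer in the deciding theorem; KEPT at this exact type (neither dropped nor restated in
place) because Theorems/WilsonMobilityGapMobilityGapSiblingReduction.lean (K1 → K2 → T →
MobilityGap), …SketchFreeDefs/Reduction.lean and …StubLightMoment.lean cite the decl. [difficulty:
open-problem] [GoltermanShamir2003, Luscher1982Topology, arXiv:hep-lat/9808010]
#9 PauliBandLimit (support, PROVED — Theorems `PauliBandLimit_proof`) — card P1: along U_e ↦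
U_e·diag(e^(iθ), e^(−iθ), 1) the r = 1 Wilson determinant is a trigonometric polynomial of degree ≤
4, Σ_{k=0}^{8} c_k e^(i(k−4)θ) (rank-2 hop projectors: ≤ two quark lines per colour per direction).
[difficulty: provable-now] [doi:10.1103/physrevd.63.114502, arXiv:hep-lat/0203026,
MontvayMunster1994]
#9 SingleLinkFlatness (support, PROVED — Theorems `PauliWegnerSea.singleLinkFlatness_proof`) — card
P2/P3 at one link, β-free Nikolskii flatness: ∃ C ∀ L U m₀ e g₀, |det D_W(U[e ↦ g₀]; m₀)|² ≤ C ∫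
|det D_W(U[e ↦ g]; m₀)|² dHaar(g) (one fixed finite-dimensional space of bidegree ≤ (6,6) link
polynomials; full support of Haar). [difficulty: provable-now] [doi:10.1007/978-1-4612-0793-1,
doi:10.1103/physrevd.63.114502, Balaban1988Convergent]
#9 SingleLinkLogFlatness (support, PROVED — Theorems `singleLinkLogFlatness_proof`) — card P3/P4,
the geometric-mean (Mahler-measure) form: ∃ c ≥ 0 ∀ L U m₀ e g₀, |det D_W(U[e ↦ g₀])| e^(−c) ≤ exp ∫
log|det D_W(U[e ↦ g])| dHaar(g) (uniform Remez/Łojasiewicz on the unit sphere of the same space;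
immune to the junk value log 0 = 0). [difficulty: M] [doi:10.1007/978-1-4612-0793-1,
doi:10.1070/im1973v007n02abeh001941, doi:10.2307/2661356]

TWO-LAYER PLAN. Foreseen glued splits (none filed now; k ≤ 3, depth 1). FMClosureUnquenched ⇐
AprioriBound (E_ν[‖adj_xy‖^s |det|^(N_f−s)]-type
fibre fractional moments from K1 + K3: the ASFH s-regularity replaced) → DecouplingLemma (ASFH Lemma
18/19 without independence:
E_full[|G_Λ(0,u)|^s ‖G(u′,x)‖^s] ≤ A_k E_full[|G_Λ(0,u)|^s], A_k polynomial in β_k and in the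
conditional in-window count) →
FMClosureUnquenched (the geometric-resolvent bootstrap itself is bookkeeping once these two hold).
ChiralOneScaleTrajectory ⇐ GoodShell
(admissibility gap: no plaquette in the ℓ₀-box with ‖1−U_p‖ ≥ ε ⇒ no spectrum of the Dirichlet H_W
below c·a_k m ⇒ Combes–Thomas
decay on the shell) → RareDislocations (phase-quenched probability of a large plaquette ≤ a_k^(q+5)
eventually: the AF large-field
bound) → ChiralOneScaleTrajectory (with (iii), (iv) and the chirality conjunct kept as pins or split
off to the sibling route's foreseen SignDefectDilution). NEW after the re-type (not filed — the
minimality predicate doubles the clause text; file when a line on #5 asks): ChiralOneScaleTrajectory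
⇐ MinimalOneScaleTrajectory (∃ reg with the package ∀ m > 0, MINIMAL: every down-shift m_crit ↦
m_crit − a_k M₀/Z_m, M₀ > 0, loses it at some m > 0) → MobilityEdgeIsChiralPoint (∀ reg,
package-minimal ⇒ IsChiralAtZero — Golterman–Shamir: the mobility edge of H_W reaches zero exactly
at the Aoki/chiral boundary, where extended near-zero modes (Banks–Casher) make the honest pion
channel gapless) → ChiralOneScaleTrajectory.

FibreCofactorDomination ⇐ TwoStarSchur (G(x,y) = adj S(W)_xy / det S(W) on the 24-dimensional {x,y}
block, S(W) = (m₀+4)·1 −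
H₀𝒲Γ𝒲†H₀†) → ModeByMode (each in-window mode cored at z costs ≤ e^(−M|d(z,x)−d(z,y)|)) →
FibreCofactorDomination.

KILL CRITERIA. Refutation of FibreCofactorDomination (a family (U_L, m₀, x, y) with sup‖adj_xy‖ /
((1+n_w) sup|det|) → ∞, e.g. hybridised
mode clusters between x and y, or det ≡ 0 on a two-star fibre with adj_xy ≢ 0) closes the route
`refuted:FibreCofactorDomination`
— the mechanism then has no deterministic core and the card's Approach B (measure-form fibre moments
only) becomes a new card, not
a repair. Refutation of TiltedFlatness (β-exponential flatness ratio or ε^(c/β) small balls on some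
outside) forces a pivot to
β-dependent constants, which OneScaleTrajectory's ∀q room may still absorb: restate K3 with (1+β)^p
↦ e^(o(β)) and re-certify.
Refutation of OneScaleTrajectory by extended in-gap modes at physical masses (IPR not shrinking) or
by failure of (iv) for N_f = 3
kills this route AND WilsonMobilityGap together (shared kill). Same for ChiralOneScaleTrajectory,
which can also die through its chirality conjunct ALONE — a theorem that no regularisation carrying
the phase-quenched package for all m > 0 is chiral at zero (localisation at a physical rate forcing
a uniform honest gap down to m = 0⁺) kills every mobility-gap route under the re-typed statement;
ChiralGluonicCompletion refuted: as for G. PhaseQuenchedFlavourDecay / GluonicCompletion refuted: as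
in the
sibling route (pivot to minors / every Wilson-fermion route dies). MobilityGap (stmt-9150) proved
directly elsewhere moots K1–K3 and
T for QCD but leaves the module (P-items) alive for the large-field routes; YangMills + a robust
perturbation theorem moots G.

NOT DECOMPOSED YET. (Re-type repair: the chirality conjunct rides inside #5 unsplit; its minimality
/ mobility-edge split is in the TWO-LAYER PLAN.) The exact finite-volume criterion interface is this
planner's design, deliberately generous: the one-scale input is asked with
room against EVERY polynomial (∀q ∃K₀) so that whichever exponent the bootstrap of
FMClosureUnquenched ends up needing is
available; once K2 closes with a definite q₀ the trajectory item should be restated with that q₀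
(glued split, not now). Box
(Dirichlet) restrictions of D_W, the boundary-term bookkeeping of the geometric resolvent identity,
the conditional (far-event)
form of K1, general link sets R ≠ two stars in K3 and the e^(c|R|) iterated flatness,
Bernstein–Walsh growth into complexified
links (the complex-strip use by HeatSlicedQuarks/QuarksAsStableAction), higher adjugates (r×r
minors, for PhaseQuenchedFlavourDecay)
and the d = 2 / U(1) / SU(2) toy versions are all layer-2 lemmas to ride with `--supports`.
Definitions (star-conditional
expectation, refit, fibre degree) are inlined as `let`s; no definition item blocks the route.

CHEAPEST FALSIFIER. RUN by the card's author (kit j002114, j002156, j002311/12, j002515/16,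
j002689/90; d = 2 on 6²/8², d = 4 on 4⁴ SU(3), Haar and smooth backgrounds, m₀ ∈ [−1.5, 0.3], tuned
det = 0 crossings): Fourier support of θ ↦ det exactly [−4,4] in d = 4 — PauliBandLimit, since
PROVED; two-star ratio max‖adj_xy‖/max|det| ≤ 1.42 (80 tuned d = 2 runs, ≤ 8 in-window modes), 1.0
(d = 4), against 38.8 for one far star (predicted tail law) and quenched E‖G‖ up to 59 (max‖G‖ =
10⁴). NEXT cheapest: the two-star test on 6⁴–8⁴ with 20–60 in-window modes (Haar, m₀ ≈ −0.9) and at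
β = 5.7–6.0 with one tuned dislocation — super-linear growth in n_w kills FibreCofactorDomination;
theory-side a compactly supported zero mode of D_W (non-abelian Aharonov–Bohm cage) gives det ≡ 0
two-star fibres where K1 needs adj_xy ≡ 0 (γ₅-hermiticity gives it for simple kernels, open for
W-dependent ones). For #5's new conjunct: any argument that physical-rate localisation of the
phase-quenched propagator persists down to the chiral line (it would force an honest gap at m = 0⁺
and kill chirality for every mobility-gap witness).

NUMBERS. Fibre degree: hop blocks rank 6 ⇒ bidegree ≤ (6,6) per link per flavour; trigonometric
degree ≤ 4 along diag(e^(iθ),e^(−iθ),1)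
(≤ 2 per colour per direction); two stars = 16 links (15 if x ~ y); dim of the band-limited bimodule
≲ 10⁹ (worst-case Nikolskii
constant) against measured single-link sup²/mean² = 1.1–1.4 (m₀ ≥ −0.2), 8–26 (m₀ ≤ −0.6, 8²),
1.1–2.2 (4⁴). Measured K1 ratios:
0.16–1.42 (two stars, det = 0 tuned), up to 38.8 (one far star); unquenched R₁ ≤ 2.8, R₂ ≤ 2.0 vs
quenched R₀ ≤ 59. Tilt: Φ_ν
drops from 2–136 (Haar law) to 1.7–4.6 at β = 16 (8²), ≤ 2.6 (4⁴). Scales of the bootstrap: ℓ₀ a_k ≤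
K₀(1+|log a_k|), gain
a_k^(s m K₀ + 3s) per shell against loss ℓ₀^q(1+β_k)^q ~ a_k^(−q)(log)^(2q), output rate δ ≈ (sK₀m +
3s − q)/K₀ physical;
β_k ≈ 4b₀ log(1/a_k) in the tree normalisation β = 2/g₀², b₀ = (11 − 2N_f/3)/(16π²); dislocation
density per site ~ e^(−β_k S_disl)
must beat ℓ₀⁴ a_k^(−q): S_disl · 4b₀ > 4 + q. Items at open: 10 (6 cruxes of which 2 shared, 3
supports, 1 assembly). After the re-type repair (2026-08-16, p117723): 12 items — 7 cruxes (K1; K3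
proved; K2; #5; D; G shared, not in the deciding theorem; #8), 4 supports (P1–P3 proved;
OneScaleTrajectory), 1 assembly (proved; its Theorems proof applied the rev-0 `closes` and must be
re-landed with the six-item logic inlined — replacement attached on stmt-QuantumFields-11517).

DEFINITION REQUESTS. None blocking (all notions inlined as `let`: star/refit, the star-conditional
tilted law, the in-window count via charpoly roots,
the phase-quenched shell moment verbatim from stmt-9150). Nice-to-have, to be filed by a tenure pass
for compact restatement:
`fibreRefit U S W` (override a configuration on a link set), `starEdges x`, `bandDegree` (Peter–Weyl
type of a function of one
link; topic Literature/MathematicalPhysics/QuantumLattice), `qcdPhaseQuenchedExpect` (already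
requested by WilsonMobilityGap). CONE FACTS (route-repairs 2026-08-15, gen 1–2; condensed
2026-08-16): the dispatcher's module-cone count of 5 unproved named facts comes from the gate header
`import Summits.QuantumFields.Statement` shared by every QCD route; none is a hypothesis of any item
or of `closes` (`#h21_route_deps`: 123 project constants, 0 unproved; exempt: `QCDOf`
statement-registry, `IsQCDAlong`, `OSData.HasMassGap/IsNonGaussian/IsNontrivial`,
`QCDRegularisation.HasMassScaling`, `QCDScheme.HasAsymptoticScaling/HasLatticeMassGap`
summit-grade); payload.imports = [] ⇒ 0 droppable. The only dischargeable one,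
Literature.MathematicalPhysics.QuantumLattice.not_isSimpleCompactGroup_unitaryGroup
(GaugeGroups.lean; provable-now, S; candidate `_holds` proofs on stmt-QuantumFields-9774, wanted as
stmt-QuantumFields-10530), is flagged for a tier-0 literature seat and deliberately NOT an item
here. Not debt: the `@[conjecture]` Clay decls ClayYangMillsEuclidean{,Gap,Along},
CaoParkSheffieldProblem; settled: isSpecification_ymSpecification refuted as stated
(`not_isSpecification_ymSpecification_indiscrete`) with its `_t2` twin proved;
`isSimpleCompactGroup_specialUnitaryGroup_holds` in tree.

Novelty: Searches (2026-08-15, this planner; the card's own 20+ queries — zbMATH/crossref/S2 `Wegner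
estimate` × {unitary Anderson, random
magnetic field, sign-indefinite, gauge/random link, analytic alloy Remez}, `random Dirac operator
gauge field localization` (0),
`Remez inequality compact Lie group` (0), galaxy `"Wegner estimate" --star all` (none gauge), galaxy
pdf `Anderson localization in
QCD` / `Wegner estimate gauge` / `localization Dirac modes gauge` (0), `lit frontier QuantumFields
--since 2021` — are listed in the
card and not repeated): `lit galaxy search "Wegner estimate" --star all` (35 rows: random
Schrödinger / RMT / multi-particle MSA —
Combes–Hislop–Mourre spectral averaging, Chulaevsky's Stollmann lemma for correlated potentials,
Klopp–Nakamura non-monotonous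
alloy Lifshitz tails, Boumaza matrix-valued Anderson; no gauge-field or compact-group entry); `lit
galaxy search "sign-indefinite
single-site potential" --star pdf` (2: Klopp–Loss–Nakamura–Stolz random displacement survey
arXiv:1107.0386, Chulaevsky);
`lit galaxy search "Remez inequality" --star all` (19: Borwein–Erdélyi GTM 161, Ganzburg "Polynomial
inequalities on measurable
sets II: weighted measures", Friedland–Yomdin on Turán–Nazarov, Brudnyi theses — the K3/LogFlatness
toolbox, nothing on gauge
fibres); `lit galaxy search "Carbery-Wright" --star pdf` (12: Boolean/log-concave analysis, none
physics); grep of all 25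
Summits/QuantumFields/QCD/Theses files for Remez|Nikolskii|anti-concentration|band-limit|Pe  [refs: 10.4171/jems/451, 10.2307/2661356, 10.1007/s00023-011-0130-3, 10.1103/physrevd.63.114502, 1107.0386, hep-lat/0203026, doi:10.4171/jems/451, doi:10.2307/2661356, doi:10.1007/s00023-011-0130-3, doi:10.1103/physrevd.63.114502, AizenmanEtAl2001]

Barriers (technique_class: polynomial-anti-concentration, fractional-moments): - technique_class: polynomial-anti-concentration, fractional-moments
- Literature.Barriers.QuantumFields.HoppingExpansionLocality: evaded by construction — nothing is
expanded in κ; the fibre degree 6N_f is the same at every κ, β, background and volume (type, not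
norm), and the card's numerics sit at κ ≈ 0.2 > 1/8.
- Literature.Barriers.QuantumFields.HoppingExpansionUniformGap: same; no background-uniform Neumann
series is claimed — decay comes from the FM bootstrap at rate ∝ a_k, and K1 is a statement about
adjugates, meaningful exactly where D_W is singular.
- Literature.Barriers.QuantumFields.AokiPhaseDichotomy: engaged only through OneScaleTrajectory's
one-scale input (extended in-gap states inside the Aoki phase void it); K1, K3, the P-items and
FMClosureUnquenched are indifferent to the phase, and the trajectory runs at a_k → 0 with fixed
physical masses, never along κ_c(β) at fixed β.
- Literature.Barriers.QuantumFields.WilsonDeterminantSign: met as in the sibling route, not evaded —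
every weight here is the phase-quenched |Π_f det| (a different ensemble, said so); K1 uses |det| and
adjugate norms and the calculus is sign-blind; the honest sign re-enters only through clause (iv)
and GluonicCompletion's reweighting.
- Literature.Barriers.QuantumFields.WilsonDeterminantMassSplitting: same answer for N_f = 3 and m₁ ≠
m₂: no positivity of the signed weight is used anywhere before GluonicCompletion; the bet (shared
with WilsonMobilityGap) is sign coherence (iv) from disloca

History (route lifecycle, newest last):
- 2026-08-16T00:14:45Z · rev 4: restated TiltedFlatness (stmt-QuantumFields-11511) — route-choice (rchoice gen 1): RESTATED crux TiltedFlatness (stmt-QuantumFields-11511) — conditionally refuted by Summit.QuantumFields.QCD.Theorems.PauliWegnerSe (planner-rchoice-QuantumFields-PauliWegnerSea-T-a89a5ab4-0)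
- 2026-08-26T05:05:35Z · DORMANT — reconciler: no traction for 8.4 d (last activity item-evidence-added at 2026-08-17T19:45:08Z); parked, not closed — `ledger route dormant route-QuantumFields-Pa (operator:999:2044746)

sub-problem: QCD · status: dormant · opened planner-plancard-QuantumFields-QCD-pauli-wegn-15ef4231-0 2026-08-15T18:17:42Z · rev 8 · ledger route-QuantumFields-PauliWegnerSea
GENERATED by the gate from the ledger (D-0016/17). Provers cite these decls: `theorem foo : Summit.QuantumFields.QCD.Theses.PauliWegnerSea.<Decl> := …` in Summits/QuantumFields/QCD/Theorems/<Name>.lean.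
-/

namespace Summit.QuantumFields.QCD.Theses.PauliWegnerSea

open scoped BigOperators Topology Manifold Classical MeasureTheory ProbabilityTheory Matrix InnerProductSpace ComplexConjugate ContinuousMap
open Filter Set Function TopologicalSpace MeasureTheory

attribute [summit_statement] _root_.QCD

/-- item stmt-QuantumFields-11510 · crux · rank 2 · open · by planner
why it might fail: Hybridised clusters of near-real modes cored BETWEEN x and y, or a W-independent near-null structure of the two-star Schur complement, could keep det small on the whole fibre while adj_xy is not: C super-linear in n_w, or even C(L) = ∞ (det ≡ 0 on a fibre where adj_xy = κφ(γ₅φ)† ≢ 0).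
sources: doi:10.4171/jems/451, AizenmanEtAl2001, AizenmanMolchanov1993, doi:10.1103/physrevd.63.114502, arXiv:hep-lat/0203026, GoltermanShamir2003
[crux] card K1, the deterministic two-star crux. For every bare mass m₀ ∈ [−2,2] there are a window
θ₀ > 0 and C₀ > 0 such that on every torus (ℤ/L)⁴ with L ≥ 4, for every SU(3) background U and every
pair of sites x ≠ y: writing refit(W) for U with the links of star(x) ∪ star(y) (e.1 = x,y or
e.1+ê.2 = x,y) replaced by those of W, D(V) = wilsonDirac (fundamental SU(3)) V m₀ 1 and n_w =
#{roots of the characteristic polynomial of γ₅D(U) with |Re| < θ₀} (in-window modes of the Hermitian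
Wilson–Dirac operator), for every W there is W′ with Σ_{a,i,b,j} ‖adj(D(refit W))_{(x,a,i),(y,b,j)}‖
≤ C₀ (1 + n_w) ‖det D(refit W′)‖ — i.e. sup_fibre ‖adj_xy‖ ≤ C₀(1+n_w) sup_fibre |det|.
γ₅-hermiticity makes two stars suffice (adj = det·G is pole-free and every pole of G carries the
same H_W-eigenvector at both ends); one far star provably does not (tail ratio e^(M|x−y|), kit
j002311 of the card). [difficulty: L] -/
@[route_item "route-QuantumFields-PauliWegnerSea", crux]
def FibreCofactorDomination : Prop :=
  open MeasureTheory Filter Literature.MathematicalPhysics.QuantumFieldTheory Literature.MathematicalPhysics.QuantumLattice Literature.Probability.LatticeModels in ∀ m₀ : ℝ, -2 ≤ m₀ → m₀ ≤ 2 → ∃ θ₀ C₀ : ℝ, 0 < θ₀ ∧ 0 < C₀ ∧ ∀ (L : ℕ) [NeZero L], 4 ≤ L → ∀ (U : GaugeConfig 4 L (Matrix.specialUnitaryGroup (Fin 3) ℂ)) (x y : TorusSite 4 L), x ≠ y → let star : Edge 4 L → Prop := fun e => e.1 = x ∨ Site.shift e.1 e.2 = x ∨ e.1 = y ∨ Site.shift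 e.1 e.2 = y; let refit : GaugeConfig 4 L (Matrix.specialUnitaryGroup (Fin 3) ℂ) → GaugeConfig 4 L (Matrix.specialUnitaryGroup (Fin 3) ℂ) := fun W e => if star e then W e else U e; let D : GaugeConfig 4 L (Matrix.specialUnitaryGroup (Fin 3) ℂ) → Matrix (TorusSite 4 L × Fin 3 × Fin 4) (TorusSite 4 L × Fin 3 × Fin 4) ℂ := fun V => wilsonDirac (fundamentalRep (Fin 3)) V m₀ 1; let nw : ℕ := Multiset.countP (fun z : ℂ => |z.re| < θ₀) (spinorLift gammaFive * D U).charpoly.roots; ∀ W : GaugeConfig 4 L (Matrix.specialUnitaryGroup (Fin 3) ℂ), ∃ W' : GaugeConfig 4 L (Matrix.specialUnitaryGroup (Fin 3) ℂ), (∑ a : Fin 3, ∑ i : Fin 4, ∑ b : Fin 3, ∑ j : Fin 4, ‖(D (refit W)).adjugate (x, a, i) (y, b, j)‖) ≤ C₀ * (1 + (nw : ℝ)) * ‖(D (refit W')).det‖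

-- earlier TiltedFlatness (stmt-QuantumFields-11511, replaced 2026-08-16T00:14:45Z -> stmt-QuantumFields-14070): retired by None — open MeasureTheory Filter Literature.MathematicalPhysics.QuantumFieldTheory Literature.MathematicalPhysics.QuantumLattice Literature.Probability.LatticeModels in ∀ Nf : ℕ, ∃ C p c : ℝ, 0 < C ∧ 0 < c ∧ ∀ β : ℝ, 0 ≤ β → ∀ mq : Fin Nf → ℝ, (∀ f, -2 ≤ mq f ∧ mq f ≤ 2) → ∀ (L 
/-- item stmt-QuantumFields-14070 · crux · rank 3 · closed · proved by Summit.QuantumFields.QCD.Theorems.CircleTransport.TiltedFlatness_proof (prover) · by planner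
why it might fail: (b′): Lipschitz untilt ν_β ≤ e(1+β)^128·Haar, then β=0 Remez/small balls on the fixed space V of link polynomials; fails only if the Łojasiewicz exponent is not uniform over the unit sphere of V|SU(3)^16 (excluded for compact analytic families, Brudnyi; unprinted on the group). Risk: p≈128·deg.
sources: CarberyWright2001, Brudnyi1999, doi:10.1070/im1973v007n02abeh001941, doi:10.1512/iumj.1995.44.1980, arXiv:math/0108212
[crux] card K3, REPAIRED (route-choice 2026-08-16, after the conditional refutation
Summit.QuantumFields.QCD.Theorems.PauliWegnerSeaTiltedFlatness_refuted @ 8ffabe2e of the rev-3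
text): Laplace–Remez on the two-star fibre with a POLYNOMIAL LOSS IN BOTH CLAUSES. For every N_f
there are C, p, c > 0 such that for every β ≥ 0, every mass tuple mq ∈ [−2,2]^N_f, every torus of
side L ≥ 4, background U and sites x, y: with F(W) = ‖det diracMatrix (refit W) mq‖ = Π_f |det
D_W(refit W; m_f)| (bidegree ≤ (6N_f, 6N_f) in each of the ≤ 16 star links), wt(W) = exp(−β ·
wilsonAction(refit W)), Haar = product Haar on all links, Z = ∫ wt, M = ∫ F·wt / Z: (a) relative
flatness F(W₀) ≤ C(1+β)^p M for every W₀ (unchanged); (b′) relative small balls with polynomial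
loss: if M > 0 then ∫ 1{F ≤ εM} wt / Z ≤ C (1+β)^p ε^c for every ε > 0 (rev ≤ 3 asked ≤ C ε^c
uniformly in β — FALSE: a Φ-symmetric twin-well outside gives ν_β(F ≤ εM_β) → ½ as β → ∞,
Cruxes/TiltedFlatness/Disproof.lean + Theorems/PauliWegnerSeaTiltedFlatnessRefutation.lean; that
witness obeys ≤ C(1+β)^{1/2} ε and misses (b′)). C′ is byte-identical to the disprover's
`TiltedFlatnessRepaired`. Constants depend on N_f only, uniformly in β, ma -/
@[route_item "route-QuantumFields-PauliWegnerSea", crux]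
def TiltedFlatness : Prop :=
  open MeasureTheory Filter Literature.MathematicalPhysics.QuantumFieldTheory Literature.MathematicalPhysics.QuantumLattice Literature.Probability.LatticeModels in ∀ Nf : ℕ, ∃ C p c : ℝ, 0 < C ∧ 0 < c ∧ ∀ β : ℝ, 0 ≤ β → ∀ mq : Fin Nf → ℝ, (∀ f, -2 ≤ mq f ∧ mq f ≤ 2) → ∀ (L : ℕ) [NeZero L], 4 ≤ L → ∀ (U : GaugeConfig 4 L (Matrix.specialUnitaryGroup (Fin 3) ℂ)) (x y : TorusSite 4 L), let star : Edge 4 L → Prop := fun e => e.1 = x ∨ Site.shift e.1 e.2 = x ∨ e.1 = y ∨ Site.shift e.1 e.2 = y; let refit : GaugeConfig 4 L (Matrix.specialUnitaryGroup (Fin 3) ℂ) → GaugeConfig 4 L (Matrix.specialUnitaryGroup (Fin 3) ℂ) := fun W e => if star e then W e else U e; let F : GaugeConfig 4 L (Matrix.specialUnitaryGroup (Fin 3) ℂ) → ℝ := fun W => ‖(diracMatrix (refit W) mq).det‖; let wt : GaugeConfig 4 L (Matrix.specialUnitaryGroup (Fin 3) ℂ) → ℝ := fun W => Real.exp (-(β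 * wilsonAction (fundamentalRep (Fin 3)) (refit W))); let haar : Measure (GaugeConfig 4 L (Matrix.specialUnitaryGroup (Fin 3) ℂ)) := Measure.pi fun _ => haarProbability (Matrix.specialUnitaryGroup (Fin 3) ℂ); let Z : ℝ := ∫ W, wt W ∂haar; let M : ℝ := (∫ W, F W * wt W ∂haar) / Z; (∀ W₀ : GaugeConfig 4 L (Matrix.specialUnitaryGroup (Fin 3) ℂ), F W₀ ≤ C * (1 + β) ^ p * M) ∧ (0 < M → ∀ ε : ℝ, 0 < ε → (∫ W, (if F W ≤ ε * M then (1 : ℝ) else 0) * wt W ∂haar) / Z ≤ C * (1 + β) ^ p * ε ^ c)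

-- `TiltedFlatness` holds: proved by `Summit.QuantumFields.QCD.Theorems.CircleTransport.TiltedFlatness_proof` (its module imports this route file, so no `_holds` link can be stated here).

/-- item stmt-QuantumFields-11512 · crux · rank 4 · open · by planner
why it might fail: (ii) is asked ∀ S ≥ L_k, but K1's (1+n_w) counts ALL modes of H_W in a k-independent window (−θ₀,θ₀) ∋ the whole low spectrum once a_k·m < θ₀: n_w ~ θ₀⁴(2S+1)⁴ is extensive, so fibre moments carry a volume factor; and the |det|-tilted law is non-product: ASFH re-sampling has no independent blocks.
sources: AizenmanEtAl2001, doi:10.4171/jems/451, AizenmanMolchanov1993, AizenmanWarzel2015, GoltermanShamir2003, EdwardsHellerNarayanan1998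
[crux] card K2, the fractional-moment bootstrap in the unquenched gauge setting.
FibreCofactorDomination → TiltedFlatness → for every N_f, every reg : QCDRegularisation N_f and
every mass tuple m > 0: IF (one-scale input) for every q there are K₀ and s ∈ (0,1) such that for
all large k some shell radius ℓ₀ ∈ [1, L_k] with ℓ₀ a_k ≤ K₀(1+|log a_k|) has ℓ₀^q (1+|β_k|)^q ·
E_{|w|,k,S}[(Σ_{colour,spin}|G_f(0,v)|)^s] ≤ 1 for all S ≥ L_k, all flavours f and all v with ‖v‖∞ =
ℓ₀ (E_{|w|,k,S} = Wilson measure at β_k on the torus of side 2S+1 reweighted by |det diracMatrix| at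
the bare masses m_f(k) = m_crit(k) + a_k m_f/Z_m(k), G = diracMatrix⁻¹ — verbatim the quantity of
MobilityGap (ii)), THEN clause (ii) of WilsonMobilityGap.MobilityGap holds for (reg, m): ∃ s, δ, C
with E_{|w|,k,S}[(Σ|G_f(0,v)|)^s] ≤ C e^(−δ a_k ‖v‖) for all large k, S ≥ L_k, v ∈ box S. The
finite-volume criterion of Aizenman–Schenker–Friedrich–Hundertmark with the a-priori bound and the
decoupling lemma supplied by K1 + K3 (fibrewise reverse Hölder under the star-conditional law)
instead of rank-one Möbius averaging over an i.i.d. potential; the logs cancel: smallness a_k^(sK₀m)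
won at ℓ₀ ~ K₀ log(1/a_k)/a_k returns th -/
@[route_item "route-QuantumFields-PauliWegnerSea", crux]
def FMClosureUnquenched : Prop :=
  open MeasureTheory Filter Literature.MathematicalPhysics.QuantumFieldTheory Literature.MathematicalPhysics.QuantumLattice Literature.Probability.LatticeModels in FibreCofactorDomination → TiltedFlatness → ∀ (Nf : ℕ) (reg : QCDRegularisation Nf) (m : Fin Nf → ℝ), (∀ f, 0 < m f) → (∀ q : ℕ, ∃ K₀ s : ℝ, 0 < s ∧ s < 1 ∧ ∀ᶠ k in atTop, ∃ ℓ₀ : ℕ, 1 ≤ ℓ₀ ∧ ℓ₀ ≤ reg.L k ∧ (ℓ₀ : ℝ) * reg.a k ≤ K₀ * (1 + |Real.log (reg.a k)|) ∧ ∀ S : ℕ, reg.L k ≤ S → ∀ (f : Fin Nf) (v : Literature.Probability.LatticeModels.Site 4), v ∈ box 4 S → ‖v‖ = (ℓ₀ : ℝ) → (ℓ₀ : ℝ) ^ q * (1 + |reg.β k|) ^ q * ((∫ U : GaugeConfig 4 (2 * S + 1) (Matrix.specialUnitaryGroup (Fin 3) ℂ), ‖(diracMatrix U fun fl => reg.mcrit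 k + reg.a k * m fl / reg.Zm k).det‖ * (∑ a : Fin 3, ∑ i : Fin 4, ∑ b : Fin 3, ∑ j : Fin 4, ‖(diracMatrix U fun fl => reg.mcrit k + reg.a k * m fl / reg.Zm k)⁻¹ (quarkEquiv (f, (Torus.proj (2 * S + 1) 0, a, i))) (quarkEquiv (f, (Torus.proj (2 * S + 1) (v), b, j)))‖) ^ s ∂(wilsonMeasure (fundamentalRep (Fin 3)) (reg.β k))) / (∫ U : GaugeConfig 4 (2 * S + 1) (Matrix.specialUnitaryGroup (Fin 3) ℂ), ‖(diracMatrix U fun fl => reg.mcrit k + reg.a k * m fl / reg.Zm k).det‖ ∂(wilsonMeasure (fundamentalRep (Fin 3)) (reg.β k)))) ≤ 1) → (∃ s δ C : ℝ, 0 < s ∧ s < 1 ∧ 0 < δ ∧ ∀ᶠ k in atTop, ∀ S : ℕ, reg.L k ≤ S → ∀ (f : Fin Nf) (v : Literature.Probability.LatticeModels.Site 4), v ∈ box 4 S → (∫ U : GaugeConfig 4 (2 * S + 1) (Matrix.specialUnitaryGroup (Fin 3) ℂ), ‖(diracMatrix U fun fl => reg.mcrit k + reg.a k * m fl / reg.Zm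 k).det‖ * (∑ a : Fin 3, ∑ i : Fin 4, ∑ b : Fin 3, ∑ j : Fin 4, ‖(diracMatrix U fun fl => reg.mcrit k + reg.a k * m fl / reg.Zm k)⁻¹ (quarkEquiv (f, (Torus.proj (2 * S + 1) 0, a, i))) (quarkEquiv (f, (Torus.proj (2 * S + 1) (v), b, j)))‖) ^ s ∂(wilsonMeasure (fundamentalRep (Fin 3)) (reg.β k))) / (∫ U : GaugeConfig 4 (2 * S + 1) (Matrix.specialUnitaryGroup (Fin 3) ℂ), ‖(diracMatrix U fun fl => reg.mcrit k + reg.a k * m fl / reg.Zm k).det‖ ∂(wilsonMeasure (fundamentalRep (Fin 3)) (reg.β k))) ≤ C * Real.exp (-(δ * (reg.a k * ‖v‖))))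

/-- item stmt-QuantumFields-17512 · crux · rank 5 · open · by planner
why it might fail: Adds Goldstone gaplessness of the SIGNED theory as m→0⁺ at the witness's own m_crit(k): a volume-uniform lower bound on a pion correlator (none in tree; (−1)^F-periodic typing) on top of 11513's open (iii)/(iv); false if localisation at physical rate holds only strictly above the chiral line.
sources: GoltermanShamir2003, SharpeSingleton1998, EdwardsHellerNarayanan1998, Luscher1977, MontvayMunster1994, JaffeWitten2000
[crux] the consumer's half after the statement re-type of 2026-08-16 (p117723: `QCDOf` gained
`reg.IsChiralAtZero`): = OneScaleTrajectory (stmt-QuantumFields-11513, now support; clauses (i),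
one-scale, (iii), (iv) verbatim) with the SAME regularisation additionally CHIRAL AT ZERO —
`reg.IsChiralAtZero`: for every ε > 0 some positive mass tuple m has ¬(reg.scheme m 0
0).HasLatticeMassGap ε, i.e. the honest signed lattice gap closes as m → 0⁺, which pins the
flavour-blind additive offset of m_crit(k) to the chiral point (the up-shift symmetry m_crit ↦
m_crit + a_k M₀/Z_m behind `qcdOf_iff_threshold` is gone). For N_f ∈ {2,3} there is reg :
QCDRegularisation N_f with HasMassScaling, IsChiralAtZero and two-loop asymptotic scaling such that
for every m > 0, along m_f(k) = m_crit(k) + a_k m_f/Z_m(k): (i) −1 < m_f(k) eventually; (one-scale)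
∀ q ∃ K₀, s ∈ (0,1): eventually in k some shell ℓ₀ ≤ L_k, ℓ₀ a_k ≤ K₀(1+|log a_k|), carries
ℓ₀^q(1+|β_k|)^q E_{|w|,k,S}[(Σ|G_f(0,v)|)^s] ≤ 1 for all S ≥ L_k, f, ‖v‖∞ = ℓ₀; (iii) the LOWER
bound c₀ e^(−C₁ a_k n − p log(n+1)) ≤ E_{|w|,k,S}[(Σ|G_f(0,n e₀)|)^s]; (iv) SIGN coherence ½ ≤
|∫det|/∫|det| at side 2L_k+1. The chirality conjunct cannot be a separa -/
@[route_item "route-QuantumFields-PauliWegnerSea", crux]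
def ChiralOneScaleTrajectory : Prop :=
  open MeasureTheory Filter Literature.MathematicalPhysics.QuantumFieldTheory Literature.MathematicalPhysics.QuantumLattice Literature.Probability.LatticeModels in ∀ Nf : ℕ, Nf = 2 ∨ Nf = 3 → ∃ reg : QCDRegularisation Nf, reg.HasMassScaling ∧ reg.IsChiralAtZero ∧ (reg.scheme 0 0 0).HasAsymptoticScaling ∧ ∀ m : Fin Nf → ℝ, (∀ f, 0 < m f) → (∀ f : Fin Nf, ∀ᶠ k in atTop, -1 < reg.mcrit k + reg.a k * m f / reg.Zm k) ∧ (∀ q : ℕ, ∃ K₀ s : ℝ, 0 < s ∧ s < 1 ∧ ∀ᶠ k in atTop, ∃ ℓ₀ : ℕ, 1 ≤ ℓ₀ ∧ ℓ₀ ≤ reg.L k ∧ (ℓ₀ : ℝ) * reg.a k ≤ K₀ * (1 + |Real.log (reg.a k)|) ∧ ∀ S : ℕ, reg.L k ≤ S → ∀ (f : Fin Nf) (v : Literature.Probability.LatticeModels.Site 4), v ∈ box 4 S → ‖v‖ = (ℓ₀ : ℝ) → (ℓ₀ : ℝ) ^ q * (1 + |reg.β k|) ^ q * ((∫ U : GaugeConfig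 4 (2 * S + 1) (Matrix.specialUnitaryGroup (Fin 3) ℂ), ‖(diracMatrix U fun fl => reg.mcrit k + reg.a k * m fl / reg.Zm k).det‖ * (∑ a : Fin 3, ∑ i : Fin 4, ∑ b : Fin 3, ∑ j : Fin 4, ‖(diracMatrix U fun fl => reg.mcrit k + reg.a k * m fl / reg.Zm k)⁻¹ (quarkEquiv (f, (Torus.proj (2 * S + 1) 0, a, i))) (quarkEquiv (f, (Torus.proj (2 * S + 1) (v), b, j)))‖) ^ s ∂(wilsonMeasure (fundamentalRep (Fin 3)) (reg.β k))) / (∫ U : GaugeConfig 4 (2 * S + 1) (Matrix.specialUnitaryGroup (Fin 3) ℂ), ‖(diracMatrix U fun fl => reg.mcrit k + reg.a k * m fl / reg.Zm k).det‖ ∂(wilsonMeasure (fundamentalRep (Fin 3)) (reg.β k)))) ≤ 1) ∧ (∃ s c₀ C₁ p : ℝ, 0 < s ∧ s < 1 ∧ 0 < c₀ ∧ ∀ᶠ k in atTop, ∀ S : ℕ, reg.L k ≤ S → ∀ (f : Fin Nf) (n : ℕ), n ≤ S → c₀ * Real.exp (-(C₁ * (reg.a k * n) + p * Real.log (n + 1)))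 ≤ (∫ U : GaugeConfig 4 (2 * S + 1) (Matrix.specialUnitaryGroup (Fin 3) ℂ), ‖(diracMatrix U fun fl => reg.mcrit k + reg.a k * m fl / reg.Zm k).det‖ * (∑ a : Fin 3, ∑ i : Fin 4, ∑ b : Fin 3, ∑ j : Fin 4, ‖(diracMatrix U fun fl => reg.mcrit k + reg.a k * m fl / reg.Zm k)⁻¹ (quarkEquiv (f, (Torus.proj (2 * S + 1) 0, a, i))) (quarkEquiv (f, (Torus.proj (2 * S + 1) (Pi.single 0 (n : ℤ)), b, j)))‖) ^ s ∂(wilsonMeasure (fundamentalRep (Fin 3)) (reg.β k))) / (∫ U : GaugeConfig 4 (2 * S + 1) (Matrix.specialUnitaryGroup (Fin 3) ℂ), ‖(diracMatrix U fun fl => reg.mcrit k + reg.a k * m fl / reg.Zm k).det‖ ∂(wilsonMeasure (fundamentalRep (Fin 3)) (reg.β k)))) ∧ (∀ᶠ k in atTop, (1 / 2 : ℝ) ≤ ‖∫ U : GaugeConfig 4 (2 * reg.L k + 1) (Matrix.specialUnitaryGroup (Fin 3) ℂ), (diracMatrix U fun fl => reg.mcrit k + reg.a k * m fl / reg.Zm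 k).det ∂(wilsonMeasure (fundamentalRep (Fin 3)) (reg.β k))‖ / (∫ U : GaugeConfig 4 (2 * reg.L k + 1) (Matrix.specialUnitaryGroup (Fin 3) ℂ), ‖(diracMatrix U fun fl => reg.mcrit k + reg.a k * m fl / reg.Zm k).det‖ ∂(wilsonMeasure (fundamentalRep (Fin 3)) (reg.β k))))

/-- item stmt-QuantumFields-9151 · crux · rank 6 · open · by planner
why it might fail: (ii) gives s<1 single-entry moments; the conclusion needs, even at n=0, volume-uniform FIRST moments of r×r minors of G_f (r≥2: baryons) under the non-product |Πdet| weight: a Minami-type bound (known for rank-one site disorder only) plus an eigenfunction-correlator step via independent disorder.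
sources: Weingarten1983, VafaWitten1984NPB, SimsWarzel2016, AizenmanWarzel2015, Minami1996, MontvayMunster1994
[crux] card K2, phase-quenched and determinantal. For every N_f, every reg : QCDRegularisation N_f
and every m > 0: the UPPER clause of MobilityGap alone implies that there is δ' > 0 such that for
every pair of gauge-invariant local lattice QCD observables A, B (any quark boxes) with A
FLAVOUR-CHARGED (some flavour f₀ and q ≠ 0 with A ↦ e^(iqθ)A under ψ_f₀ ↦ e^(iθ)ψ_f₀, ψ̄_f₀ ↦
e^(−iθ)ψ̄_f₀) there is C' with, for all large k, all S ≥ L_k and n ≤ S, |E_{|w|}[⟨A(0)·B(n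
e₀)⟩_F(U)]| ≤ C' e^(−δ' a_k n), ⟨·⟩_F(U) the Berezin ratio in the background U (charged A has ⟨A⟩_F
≡ 0, so this IS the connected correlator of the phase-quenched ensemble). Mechanism: Wick's theorem
in determinant form — ⟨AB⟩_F·Π_f det D_f is a sum of products of COMPLEMENTARY MINORS of the D_f
(Jacobi), bounded configuration-wise, and flavour charge forces ≥ |q| quark lines of flavour f₀
across the separation in every term; the upgrade from single-entry s<1 moments to first moments of
minors is the lattice analogue of the eigenfunction-correlator / determinantal-decay step of
localisation theory. [deps: MobilityGap] [difficulty: L] -/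
@[route_item "route-QuantumFields-PauliWegnerSea", crux]
def PhaseQuenchedFlavourDecay : Prop :=
  open MeasureTheory Filter Literature.MathematicalPhysics.QuantumFieldTheory Literature.MathematicalPhysics.QuantumLattice Literature.Probability.LatticeModels in ∀ (Nf : ℕ) (reg : QCDRegularisation Nf) (m : Fin Nf → ℝ), (∀ f, 0 < m f) → (∃ s δ C : ℝ, 0 < s ∧ s < 1 ∧ 0 < δ ∧ ∀ᶠ k in atTop, ∀ S : ℕ, reg.L k ≤ S → ∀ (f : Fin Nf) (v : Literature.Probability.LatticeModels.Site 4), v ∈ box 4 S → (∫ U : GaugeConfig 4 (2 * S + 1) (Matrix.specialUnitaryGroup (Fin 3) ℂ), ‖(diracMatrix U fun fl => reg.mcrit k + reg.a k * m fl / reg.Zm k).det‖ * (∑ a : Fin 3, ∑ i : Fin 4, ∑ b : Fin 3, ∑ j : Fin 4, ‖(diracMatrix U fun fl => reg.mcrit k + reg.a k * m fl / reg.Zm k)⁻¹ (quarkEquiv (f, (Torus.proj (2 * S + 1) 0, a, i))) (quarkEquiv (f, (Torus.proj (2 * S + 1) (v), b, j)))‖) ^ s ∂(wilsonMeasure (fundamentalRep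 (Fin 3)) (reg.β k))) / (∫ U : GaugeConfig 4 (2 * S + 1) (Matrix.specialUnitaryGroup (Fin 3) ℂ), ‖(diracMatrix U fun fl => reg.mcrit k + reg.a k * m fl / reg.Zm k).det‖ ∂(wilsonMeasure (fundamentalRep (Fin 3)) (reg.β k))) ≤ C * Real.exp (-(δ * (reg.a k * ‖v‖)))) → (∃ δ' : ℝ, 0 < δ' ∧ ∀ (R R' : ℕ) (A : QCDLatticeObservable Nf R) (B : QCDLatticeObservable Nf R'), (∃ (f₀ : Fin Nf) (q : ℤ), q ≠ 0 ∧ ∀ (θ : ℝ) (U : LGConfig 4 (Matrix.specialUnitaryGroup (Fin 3) ℂ)), ExteriorAlgebra.map (LinearMap.pi fun w => (Sum.elim (fun i => if (boxQuarkEquiv.symm i).1 = f₀ then Complex.exp (-((θ : ℂ) * Complex.I)) else 1) (fun i => if (boxQuarkEquiv.symm i).1 = f₀ then Complex.exp ((θ : ℂ) * Complex.I) else 1) (ofLex w)) • LinearMap.proj w) (A.F U) = Complex.exp (((q : ℝ) * θ : ℝ) * Complex.I) • A.F U) → ∃ C' : ℝ, ∀ᶠ k in atTop, ∀ S : ℕ,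 reg.L k ≤ S → ∀ n : ℕ, n ≤ S → ‖(∫ U : GaugeConfig 4 (2 * S + 1) (Matrix.specialUnitaryGroup (Fin 3) ℂ), (‖(diracMatrix U fun fl => reg.mcrit k + reg.a k * m fl / reg.Zm k).det‖ : ℂ) * (fermiIntegral (A.onTorus (2 * S + 1) 0 U * B.onTorus (2 * S + 1) (Pi.single 0 (n : ℤ)) U * fermiBoltzmann U fun fl => reg.mcrit k + reg.a k * m fl / reg.Zm k) / fermiIntegral (fermiBoltzmann U fun fl => reg.mcrit k + reg.a k * m fl / reg.Zm k)) ∂(wilsonMeasure (fundamentalRep (Fin 3)) (reg.β k))) / (∫ U : GaugeConfig 4 (2 * S + 1) (Matrix.specialUnitaryGroup (Fin 3) ℂ), (‖(diracMatrix U fun fl => reg.mcrit k + reg.a k * m fl / reg.Zm k).det‖ : ℂ) ∂(wilsonMeasure (fundamentalRep (Fin 3)) (reg.β k)))‖ ≤ C' * Real.exp (-(δ' * (reg.a k * n))))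

/-- item stmt-QuantumFields-17498 · crux · rank 8 · open · by planner
why it might fail: Contains the YM gap exactly as 9152: sign coherence only at side 2L_k+1 while HasLatticeMassGap needs all S ≥ L_k (⟨σ⟩_|w| ~ exp(−c(a_kS)^4) → 0) ⇒ convergent sign-defect expansion = uniform gluonic clustering at weak coupling, open; plus E0–E4, non-Gaussian glue. Chirality is given, not produced.
sources: JaffeWitten2000, Balaban1988Convergent, OsterwalderSeiler1978, Luscher1977, MohlerSchaefer2020, SeilerLNP1982
[crux] K3 with the chiral pin as INPUT (statement re-type p117723). For N_f ∈ {2,3}: if some reg :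
QCDRegularisation N_f has HasMassScaling, reg.IsChiralAtZero, asymptotic scaling and, for every m >
0, clauses (i)–(iv) of (Chiral)MobilityGap together with the conclusion of PhaseQuenchedFlavourDecay
(flavour-charged phase-quenched decay at rate δ' a_k), then QCDOf N_f holds — i.e. such a CHIRAL,
localised, sign-coherent, flavour-gapped Wilson trajectory can be completed to OS data with
IsQCDAlong, non-trivial non-Gaussian glue, non-decoupled flavour-changing pseudoscalars,
T.HasMassGap Δ and the FULL HasLatticeMassGap Δ for every m > 0, by a witness regularisation that is
itself chiral at zero: the completion may choose z, shift (IsChiralAtZero reads reg.scheme m 0 0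
only), keep reg, or pass to a subsequence retaining the chiral witnesses (countably many (ε_j, m_j),
diagonal choice), but may NO LONGER shift the flavour-blind offset; the signed weight (dilute
sign-defect gas, reweighting ⟨·σ⟩_{|w|}/⟨σ⟩_{|w|}), the flavour-NEUTRAL and gluonic channels
(hairpins, glueballs) and the continuum limit are its content. Text = GluonicCompletion's with
`reg.IsChiralAtZero ∧` inserted after `r -/
@[route_item "route-QuantumFields-PauliWegnerSea", crux]
def ChiralGluonicCompletion : Prop :=
  open MeasureTheory Filter Literature.MathematicalPhysics.QuantumFieldTheory Literature.MathematicalPhysics.QuantumLattice Literature.Probability.LatticeModels in ∀ Nf : ℕ, Nf = 2 ∨ Nf = 3 → (∃ reg : QCDRegularisation Nf, reg.HasMassScaling ∧ reg.IsChiralAtZero ∧ (reg.scheme 0 0 0).HasAsymptoticScaling ∧ ∀ m : Fin Nf → ℝ, (∀ f, 0 < m f) → ((∀ f : Fin Nf, ∀ᶠ k in atTop, -1 < reg.mcrit k + reg.a k * m f / reg.Zm k) ∧ (∃ s δ C : ℝ, 0 < s ∧ s < 1 ∧ 0 < δ ∧ ∀ᶠ k in atTop, ∀ S : ℕ, reg.L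 k ≤ S → ∀ (f : Fin Nf) (v : Literature.Probability.LatticeModels.Site 4), v ∈ box 4 S → (∫ U : GaugeConfig 4 (2 * S + 1) (Matrix.specialUnitaryGroup (Fin 3) ℂ), ‖(diracMatrix U fun fl => reg.mcrit k + reg.a k * m fl / reg.Zm k).det‖ * (∑ a : Fin 3, ∑ i : Fin 4, ∑ b : Fin 3, ∑ j : Fin 4, ‖(diracMatrix U fun fl => reg.mcrit k + reg.a k * m fl / reg.Zm k)⁻¹ (quarkEquiv (f, (Torus.proj (2 * S + 1) 0, a, i))) (quarkEquiv (f, (Torus.proj (2 * S + 1) (v), b, j)))‖) ^ s ∂(wilsonMeasure (fundamentalRep (Fin 3)) (reg.β k))) / (∫ U : GaugeConfig 4 (2 * S + 1) (Matrix.specialUnitaryGroup (Fin 3) ℂ), ‖(diracMatrix U fun fl => reg.mcrit k + reg.a k * m fl / reg.Zm k).det‖ ∂(wilsonMeasure (fundamentalRep (Fin 3)) (reg.β k))) ≤ C * Real.exp (-(δ * (reg.a k * ‖v‖)))) ∧ (∃ s c₀ C₁ p : ℝ, 0 < s ∧ s < 1 ∧ 0 < c₀ ∧ ∀ᶠ k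 in atTop, ∀ S : ℕ, reg.L k ≤ S → ∀ (f : Fin Nf) (n : ℕ), n ≤ S → c₀ * Real.exp (-(C₁ * (reg.a k * n) + p * Real.log (n + 1))) ≤ (∫ U : GaugeConfig 4 (2 * S + 1) (Matrix.specialUnitaryGroup (Fin 3) ℂ), ‖(diracMatrix U fun fl => reg.mcrit k + reg.a k * m fl / reg.Zm k).det‖ * (∑ a : Fin 3, ∑ i : Fin 4, ∑ b : Fin 3, ∑ j : Fin 4, ‖(diracMatrix U fun fl => reg.mcrit k + reg.a k * m fl / reg.Zm k)⁻¹ (quarkEquiv (f, (Torus.proj (2 * S + 1) 0, a, i))) (quarkEquiv (f, (Torus.proj (2 * S + 1) (Pi.single 0 (n : ℤ)), b, j)))‖) ^ s ∂(wilsonMeasure (fundamentalRep (Fin 3)) (reg.β k))) / (∫ U : GaugeConfig 4 (2 * S + 1) (Matrix.specialUnitaryGroup (Fin 3) ℂ), ‖(diracMatrix U fun fl => reg.mcrit k + reg.a k * m fl / reg.Zm k).det‖ ∂(wilsonMeasure (fundamentalRep (Fin 3)) (reg.β k)))) ∧ (∀ᶠ k in atTop, (1 / 2 : ℝ) ≤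 ‖∫ U : GaugeConfig 4 (2 * reg.L k + 1) (Matrix.specialUnitaryGroup (Fin 3) ℂ), (diracMatrix U fun fl => reg.mcrit k + reg.a k * m fl / reg.Zm k).det ∂(wilsonMeasure (fundamentalRep (Fin 3)) (reg.β k))‖ / (∫ U : GaugeConfig 4 (2 * reg.L k + 1) (Matrix.specialUnitaryGroup (Fin 3) ℂ), ‖(diracMatrix U fun fl => reg.mcrit k + reg.a k * m fl / reg.Zm k).det‖ ∂(wilsonMeasure (fundamentalRep (Fin 3)) (reg.β k))))) ∧ (∃ δ' : ℝ, 0 < δ' ∧ ∀ (R R' : ℕ) (A : QCDLatticeObservable Nf R) (B : QCDLatticeObservable Nf R'), (∃ (f₀ : Fin Nf) (q : ℤ), q ≠ 0 ∧ ∀ (θ : ℝ) (U : LGConfig 4 (Matrix.specialUnitaryGroup (Fin 3) ℂ)), ExteriorAlgebra.map (LinearMap.pi fun w => (Sum.elim (fun i => if (boxQuarkEquiv.symm i).1 = f₀ then Complex.exp (-((θ : ℂ) * Complex.I)) else 1) (fun i => if (boxQuarkEquiv.symm i).1 = f₀ then Complex.exp ((θ : ℂ) * Complex.I) else 1) (ofLex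 w)) • LinearMap.proj w) (A.F U) = Complex.exp (((q : ℝ) * θ : ℝ) * Complex.I) • A.F U) → ∃ C' : ℝ, ∀ᶠ k in atTop, ∀ S : ℕ, reg.L k ≤ S → ∀ n : ℕ, n ≤ S → ‖(∫ U : GaugeConfig 4 (2 * S + 1) (Matrix.specialUnitaryGroup (Fin 3) ℂ), (‖(diracMatrix U fun fl => reg.mcrit k + reg.a k * m fl / reg.Zm k).det‖ : ℂ) * (fermiIntegral (A.onTorus (2 * S + 1) 0 U * B.onTorus (2 * S + 1) (Pi.single 0 (n : ℤ)) U * fermiBoltzmann U fun fl => reg.mcrit k + reg.a k * m fl / reg.Zm k) / fermiIntegral (fermiBoltzmann U fun fl => reg.mcrit k + reg.a k * m fl / reg.Zm k)) ∂(wilsonMeasure (fundamentalRep (Fin 3)) (reg.β k))) / (∫ U : GaugeConfig 4 (2 * S + 1) (Matrix.specialUnitaryGroup (Fin 3) ℂ), (‖(diracMatrix U fun fl => reg.mcrit k + reg.a k * m fl / reg.Zm k).det‖ : ℂ) ∂(wilsonMeasure (fundamentalRep (Fin 3)) (reg.β k)))‖ ≤ C' * Real.exp (-(δ' * (reg.a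 k * n))))) → QCDOf Nf

/-- item stmt-QuantumFields-11513 · support · rank 5 · open · by planner
why it might fail: A YM-UV slice (AF scheme with HasAsymptoticScaling) plus two unproved inputs: in-gap H_W modes exponentially localised (dislocation density is a FIXED power a_k^(4b₀S_d), so ∀q over-asks without localisation; false if the mobility edge vanishes: Aoki phase) and sign coherence (iv), open for N_f = 3.
sources: GoltermanShamir2003, Luscher1982Topology, arXiv:hep-lat/9808010
[crux] the consumer's half (Lifshitz input + honesty pins), = WilsonMobilityGap.MobilityGap with
clause (ii) REPLACED by the one-scale input of FMClosureUnquenched. For N_f ∈ {2,3} there is reg :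
QCDRegularisation N_f with HasMassScaling and two-loop asymptotic scaling such that for every m > 0,
along m_f(k) = m_crit(k) + a_k m_f/Z_m(k): (i) −1 < m_f(k) eventually; (one-scale) ∀ q ∃ K₀, s ∈
(0,1): eventually in k some shell ℓ₀ ≤ L_k, ℓ₀ a_k ≤ K₀(1+|log a_k|), carries ℓ₀^q(1+|β_k|)^q
E_{|w|,k,S}[(Σ|G_f(0,v)|)^s] ≤ 1 for all S ≥ L_k, f, ‖v‖∞ = ℓ₀; (iii) the LOWER bound c₀ e^(−C₁ a_k
n − p log(n+1)) ≤ E_{|w|,k,S}[(Σ|G_f(0,n e₀)|)^s] (quarks not lattice-heavy); (iv) SIGN coherence |∫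
det diracMatrix dμ_W| ≥ ½ ∫ |det diracMatrix| dμ_W at the scheme's own side 2L_k+1 — (i), (iii),
(iv) verbatim from stmt-QuantumFields-9150. Physics: in-gap modes of H_W below a_k m/2 come only
from lattice dislocations, whose physical density vanishes like a power of a_k on an AF trajectory
(Lüscher's bound; Hernández–Jansen–Lüscher admissibility ⇒ smooth fields are gapped), so a log-scale
shell is good with overwhelming probability and Combes–Thomas decay inside it wins a power
a_k^(smK₀) against polynom -/
@[route_item "route-QuantumFields-PauliWegnerSea"]
def OneScaleTrajectory : Prop :=
  open MeasureTheory Filter Literature.MathematicalPhysics.QuantumFieldTheory Literature.MathematicalPhysics.QuantumLattice Literature.Probability.LatticeModels in ∀ Nf : ℕ, Nf = 2 ∨ Nf = 3 → ∃ reg : QCDRegularisation Nf, reg.HasMassScaling ∧ (reg.scheme 0 0 0).HasAsymptoticScaling ∧ ∀ m : Fin Nf → ℝ, (∀ f, 0 < m f) → (∀ f : Fin Nf, ∀ᶠ k in atTop, -1 < reg.mcrit k + reg.a k * m f / reg.Zm k) ∧ (∀ q : ℕ, ∃ K₀ s : ℝ, 0 < s ∧ s < 1 ∧ ∀ᶠ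 k in atTop, ∃ ℓ₀ : ℕ, 1 ≤ ℓ₀ ∧ ℓ₀ ≤ reg.L k ∧ (ℓ₀ : ℝ) * reg.a k ≤ K₀ * (1 + |Real.log (reg.a k)|) ∧ ∀ S : ℕ, reg.L k ≤ S → ∀ (f : Fin Nf) (v : Literature.Probability.LatticeModels.Site 4), v ∈ box 4 S → ‖v‖ = (ℓ₀ : ℝ) → (ℓ₀ : ℝ) ^ q * (1 + |reg.β k|) ^ q * ((∫ U : GaugeConfig 4 (2 * S + 1) (Matrix.specialUnitaryGroup (Fin 3) ℂ), ‖(diracMatrix U fun fl => reg.mcrit k + reg.a k * m fl / reg.Zm k).det‖ * (∑ a : Fin 3, ∑ i : Fin 4, ∑ b : Fin 3, ∑ j : Fin 4, ‖(diracMatrix U fun fl => reg.mcrit k + reg.a k * m fl / reg.Zm k)⁻¹ (quarkEquiv (f, (Torus.proj (2 * S + 1) 0, a, i))) (quarkEquiv (f, (Torus.proj (2 * S + 1) (v), b, j)))‖) ^ s ∂(wilsonMeasure (fundamentalRep (Fin 3)) (reg.β k))) / (∫ U : GaugeConfig 4 (2 * S + 1) (Matrix.specialUnitaryGroup (Fin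 3) ℂ), ‖(diracMatrix U fun fl => reg.mcrit k + reg.a k * m fl / reg.Zm k).det‖ ∂(wilsonMeasure (fundamentalRep (Fin 3)) (reg.β k)))) ≤ 1) ∧ (∃ s c₀ C₁ p : ℝ, 0 < s ∧ s < 1 ∧ 0 < c₀ ∧ ∀ᶠ k in atTop, ∀ S : ℕ, reg.L k ≤ S → ∀ (f : Fin Nf) (n : ℕ), n ≤ S → c₀ * Real.exp (-(C₁ * (reg.a k * n) + p * Real.log (n + 1))) ≤ (∫ U : GaugeConfig 4 (2 * S + 1) (Matrix.specialUnitaryGroup (Fin 3) ℂ), ‖(diracMatrix U fun fl => reg.mcrit k + reg.a k * m fl / reg.Zm k).det‖ * (∑ a : Fin 3, ∑ i : Fin 4, ∑ b : Fin 3, ∑ j : Fin 4, ‖(diracMatrix U fun fl => reg.mcrit k + reg.a k * m fl / reg.Zm k)⁻¹ (quarkEquiv (f, (Torus.proj (2 * S + 1) 0, a, i))) (quarkEquiv (f, (Torus.proj (2 * S + 1) (Pi.single 0 (n : ℤ)), b, j)))‖) ^ s ∂(wilsonMeasure (fundamentalRep (Fin 3)) (reg.β k))) / (∫ U : GaugeConfig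 4 (2 * S + 1) (Matrix.specialUnitaryGroup (Fin 3) ℂ), ‖(diracMatrix U fun fl => reg.mcrit k + reg.a k * m fl / reg.Zm k).det‖ ∂(wilsonMeasure (fundamentalRep (Fin 3)) (reg.β k)))) ∧ (∀ᶠ k in atTop, (1 / 2 : ℝ) ≤ ‖∫ U : GaugeConfig 4 (2 * reg.L k + 1) (Matrix.specialUnitaryGroup (Fin 3) ℂ), (diracMatrix U fun fl => reg.mcrit k + reg.a k * m fl / reg.Zm k).det ∂(wilsonMeasure (fundamentalRep (Fin 3)) (reg.β k))‖ / (∫ U : GaugeConfig 4 (2 * reg.L k + 1) (Matrix.specialUnitaryGroup (Fin 3) ℂ), ‖(diracMatrix U fun fl => reg.mcrit k + reg.a k * m fl / reg.Zm k).det‖ ∂(wilsonMeasure (fundamentalRep (Fin 3)) (reg.β k))))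

/-- item stmt-QuantumFields-9152 · support · rank 7 · open · by planner
why it might fail: Contains the YM gap: sign coherence comes only at side 2L_k+1 but HasLatticeMassGap needs all S≥L_k, where ⟨σ⟩_|w|~exp(−c(a_kS)^4)→0, so signed ratios need a convergent sign-defect polymer expansion = uniform gluonic clustering at weak coupling (open); plus E0–E4, rotations, non-Gaussian glue.
sources: JaffeWitten2000, Balaban1988Convergent, OsterwalderSeiler1978, Luscher1977, MohlerSchaefer2020, SeilerLNP1982
[crux] card K3 + UV, the Yang–Mills-hard remainder. For N_f ∈ {2,3}: if some reg : QCDRegularisation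
N_f has HasMassScaling, asymptotic scaling and, for every m > 0, clauses (i)–(iv) of MobilityGap
together with the conclusion of PhaseQuenchedFlavourDecay, then QCDOf N_f holds — i.e. such a
localised, sign-coherent, flavour-gapped Wilson trajectory can be completed (passing to
subsequences, shifting the flavour-blind offset, choosing z, shift) to OS data with IsQCDAlong,
non-trivial non-Gaussian glue, non-decoupled flavour-changing pseudoscalars, T.HasMassGap Δ and the
FULL HasLatticeMassGap Δ: the signed weight (dilute sign-defect gas, reweighting
⟨·σ⟩_{|w|}/⟨σ⟩_{|w|}), the flavour-NEUTRAL and purely gluonic channels (hairpins, glueballs) and the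
continuum limit. [deps: MobilityGap, PhaseQuenchedFlavourDecay] [difficulty: open-problem] -/
@[route_item "route-QuantumFields-PauliWegnerSea"]
def GluonicCompletion : Prop :=
  open MeasureTheory Filter Literature.MathematicalPhysics.QuantumFieldTheory Literature.MathematicalPhysics.QuantumLattice Literature.Probability.LatticeModels in ∀ Nf : ℕ, Nf = 2 ∨ Nf = 3 → (∃ reg : QCDRegularisation Nf, reg.HasMassScaling ∧ (reg.scheme 0 0 0).HasAsymptoticScaling ∧ ∀ m : Fin Nf → ℝ, (∀ f, 0 < m f) → ((∀ f : Fin Nf, ∀ᶠ k in atTop, -1 < reg.mcrit k + reg.a k * m f / reg.Zm k) ∧ (∃ s δ C : ℝ, 0 < s ∧ s < 1 ∧ 0 < δ ∧ ∀ᶠ k in atTop, ∀ S : ℕ, reg.L k ≤ S → ∀ (f : Fin Nf) (v : Literature.Probability.LatticeModels.Site 4), v ∈ box 4 S → (∫ U : GaugeConfig 4 (2 * S + 1) (Matrix.specialUnitaryGroup (Fin 3) ℂ), ‖(diracMatrix U fun fl => reg.mcrit k + reg.a k * m fl / reg.Zm k).det‖ * (∑ a : Fin 3, ∑ i : Fin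 4, ∑ b : Fin 3, ∑ j : Fin 4, ‖(diracMatrix U fun fl => reg.mcrit k + reg.a k * m fl / reg.Zm k)⁻¹ (quarkEquiv (f, (Torus.proj (2 * S + 1) 0, a, i))) (quarkEquiv (f, (Torus.proj (2 * S + 1) (v), b, j)))‖) ^ s ∂(wilsonMeasure (fundamentalRep (Fin 3)) (reg.β k))) / (∫ U : GaugeConfig 4 (2 * S + 1) (Matrix.specialUnitaryGroup (Fin 3) ℂ), ‖(diracMatrix U fun fl => reg.mcrit k + reg.a k * m fl / reg.Zm k).det‖ ∂(wilsonMeasure (fundamentalRep (Fin 3)) (reg.β k))) ≤ C * Real.exp (-(δ * (reg.a k * ‖v‖)))) ∧ (∃ s c₀ C₁ p : ℝ, 0 < s ∧ s < 1 ∧ 0 < c₀ ∧ ∀ᶠ k in atTop, ∀ S : ℕ, reg.L k ≤ S → ∀ (f : Fin Nf) (n : ℕ), n ≤ S → c₀ * Real.exp (-(C₁ * (reg.a k * n) + p * Real.log (n + 1))) ≤ (∫ U : GaugeConfig 4 (2 * S + 1) (Matrix.specialUnitaryGroup (Fin 3) ℂ), ‖(diracMatrix U fun fl => reg.mcrit k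 + reg.a k * m fl / reg.Zm k).det‖ * (∑ a : Fin 3, ∑ i : Fin 4, ∑ b : Fin 3, ∑ j : Fin 4, ‖(diracMatrix U fun fl => reg.mcrit k + reg.a k * m fl / reg.Zm k)⁻¹ (quarkEquiv (f, (Torus.proj (2 * S + 1) 0, a, i))) (quarkEquiv (f, (Torus.proj (2 * S + 1) (Pi.single 0 (n : ℤ)), b, j)))‖) ^ s ∂(wilsonMeasure (fundamentalRep (Fin 3)) (reg.β k))) / (∫ U : GaugeConfig 4 (2 * S + 1) (Matrix.specialUnitaryGroup (Fin 3) ℂ), ‖(diracMatrix U fun fl => reg.mcrit k + reg.a k * m fl / reg.Zm k).det‖ ∂(wilsonMeasure (fundamentalRep (Fin 3)) (reg.β k)))) ∧ (∀ᶠ k in atTop, (1 / 2 : ℝ) ≤ ‖∫ U : GaugeConfig 4 (2 * reg.L k + 1) (Matrix.specialUnitaryGroup (Fin 3) ℂ), (diracMatrix U fun fl => reg.mcrit k + reg.a k * m fl / reg.Zm k).det ∂(wilsonMeasure (fundamentalRep (Fin 3)) (reg.β k))‖ / (∫ U : GaugeConfig 4 (2 * reg.L k + 1) (Matrix.specialUnitaryGroup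 (Fin 3) ℂ), ‖(diracMatrix U fun fl => reg.mcrit k + reg.a k * m fl / reg.Zm k).det‖ ∂(wilsonMeasure (fundamentalRep (Fin 3)) (reg.β k))))) ∧ (∃ δ' : ℝ, 0 < δ' ∧ ∀ (R R' : ℕ) (A : QCDLatticeObservable Nf R) (B : QCDLatticeObservable Nf R'), (∃ (f₀ : Fin Nf) (q : ℤ), q ≠ 0 ∧ ∀ (θ : ℝ) (U : LGConfig 4 (Matrix.specialUnitaryGroup (Fin 3) ℂ)), ExteriorAlgebra.map (LinearMap.pi fun w => (Sum.elim (fun i => if (boxQuarkEquiv.symm i).1 = f₀ then Complex.exp (-((θ : ℂ) * Complex.I)) else 1) (fun i => if (boxQuarkEquiv.symm i).1 = f₀ then Complex.exp ((θ : ℂ) * Complex.I) else 1) (ofLex w)) • LinearMap.proj w) (A.F U) = Complex.exp (((q : ℝ) * θ : ℝ) * Complex.I) • A.F U) → ∃ C' : ℝ, ∀ᶠ k in atTop, ∀ S : ℕ, reg.L k ≤ S → ∀ n : ℕ, n ≤ S → ‖(∫ U : GaugeConfig 4 (2 * S + 1) (Matrix.specialUnitaryGroup (Fin 3) ℂ),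 (‖(diracMatrix U fun fl => reg.mcrit k + reg.a k * m fl / reg.Zm k).det‖ : ℂ) * (fermiIntegral (A.onTorus (2 * S + 1) 0 U * B.onTorus (2 * S + 1) (Pi.single 0 (n : ℤ)) U * fermiBoltzmann U fun fl => reg.mcrit k + reg.a k * m fl / reg.Zm k) / fermiIntegral (fermiBoltzmann U fun fl => reg.mcrit k + reg.a k * m fl / reg.Zm k)) ∂(wilsonMeasure (fundamentalRep (Fin 3)) (reg.β k))) / (∫ U : GaugeConfig 4 (2 * S + 1) (Matrix.specialUnitaryGroup (Fin 3) ℂ), (‖(diracMatrix U fun fl => reg.mcrit k + reg.a k * m fl / reg.Zm k).det‖ : ℂ) ∂(wilsonMeasure (fundamentalRep (Fin 3)) (reg.β k)))‖ ≤ C' * Real.exp (-(δ' * (reg.a k * n))))) → QCDOf Nf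

/-- item stmt-QuantumFields-11514 · support · rank 9 · closed · proved by Summit.QuantumFields.QCD.Theorems.PauliBandLimit_proof (prover) · by planner
sources: doi:10.1103/physrevd.63.114502, arXiv:hep-lat/0203026, MontvayMunster1994
[support] card P1, the first Lean-checkable face of the mechanism (provable now by multilinearity of
det + rank 2 of (1∓γ_μ)/2, or by the card's kit certificate j002689 turned into a proof): for every
torus, background U, bare mass m₀, edge e and every one-parameter family T(θ) ∈ SU(3) with matrix
diag(e^(iθ), e^(−iθ), 1), the function θ ↦ det wilsonDirac(U with U_e ↦ U_e·T(θ); m₀, r = 1) is a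
trigonometric polynomial of degree ≤ 4: = Σ_{k=0}^{8} c_k e^(i(k−4)θ) (at most two quark lines per
colour cross a link each way: any minor of (1−γ_μ)/2 ⊗ g using three columns of one colour
vanishes). [difficulty: provable-now] -/
@[route_item "route-QuantumFields-PauliWegnerSea"]
def PauliBandLimit : Prop :=
  open MeasureTheory Filter Literature.MathematicalPhysics.QuantumFieldTheory Literature.MathematicalPhysics.QuantumLattice Literature.Probability.LatticeModels in ∀ (L : ℕ) [NeZero L] (U : GaugeConfig 4 L (Matrix.specialUnitaryGroup (Fin 3) ℂ)) (m₀ : ℝ) (e : Edge 4 L) (T : ℝ → Matrix.specialUnitaryGroup (Fin 3) ℂ), (∀ θ : ℝ, ((T θ : Matrix.specialUnitaryGroup (Fin 3) ℂ) : Matrix (Fin 3) (Fin 3) ℂ) = Matrix.diagonal ![Complex.exp (θ * Complex.I), Complex.exp (-(θ * Complex.I)), 1]) → ∃ c : Fin 9 → ℂ, ∀ θ : ℝ, (wilsonDirac (fundamentalRep (Fin 3)) (Function.update U e (U e * T θ)) m₀ 1).det = ∑ k : Fin 9, c k * Complex.exp ((((k : ℕ) : ℝ) - 4 : ℝ) *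 θ * Complex.I)

-- `PauliBandLimit` holds: proved by `Summit.QuantumFields.QCD.Theorems.PauliBandLimit_proof` (its module imports this route file, so no `_holds` link can be stated here).

/-- item stmt-QuantumFields-11515 · support · rank 9 · closed · proved by Summit.QuantumFields.QCD.Theorems.PauliWegnerSea.singleLinkFlatness_proof (prover) · by planner
sources: doi:10.1007/978-1-4612-0793-1, doi:10.1103/physrevd.63.114502, Balaban1988Convergent
[support] card P2/P3 at one link, β-free Nikolskii flatness (provable now: g ↦ det D_W(U[e ↦ g])
ranges, for ALL L, U, m₀, e, in ONE finite-dimensional space V of polynomial functions of bidegree ≤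
(6,6) on SU(3), on which sup-norm² ≤ C · L²(Haar)-norm² by finite-dimensionality and full support of
Haar; C = dim V by the reproducing kernel): ∃ C, ∀ L U m₀ e g₀, ‖det D_W(U[e ↦ g₀]; m₀)‖² ≤ C ∫ ‖det
D_W(U[e ↦ g]; m₀)‖² dHaar(g). The sea cannot peak on a link above its fibre mean — the |R| = 1 case
of the large-field flatness consumed by the Bałaban-type routes (HeavyThresholdYMBridge,
HeatSlicedQuarks, QuarksAsStableAction) in place of configuration-wise diamagnetism. [difficulty:
provable-now] -/
@[route_item "route-QuantumFields-PauliWegnerSea"]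
def SingleLinkFlatness : Prop :=
  open MeasureTheory Filter Literature.MathematicalPhysics.QuantumFieldTheory Literature.MathematicalPhysics.QuantumLattice Literature.Probability.LatticeModels in ∃ C : ℝ, ∀ (L : ℕ) [NeZero L] (U : GaugeConfig 4 L (Matrix.specialUnitaryGroup (Fin 3) ℂ)) (m₀ : ℝ) (e : Edge 4 L) (g₀ : Matrix.specialUnitaryGroup (Fin 3) ℂ), ‖(wilsonDirac (fundamentalRep (Fin 3)) (Function.update U e g₀) m₀ 1).det‖ ^ 2 ≤ C * ∫ g, ‖(wilsonDirac (fundamentalRep (Fin 3)) (Function.update U e g) m₀ 1).det‖ ^ 2 ∂(haarProbability (Matrix.specialUnitaryGroup (Fin 3) ℂ))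

-- `SingleLinkFlatness` holds: proved by `Summit.QuantumFields.QCD.Theorems.PauliWegnerSea.singleLinkFlatness_proof` (its module imports this route file, so no `_holds` link can be stated here).

/-- item stmt-QuantumFields-11516 · support · rank 9 · closed · proved by Summit.QuantumFields.QCD.Theorems.singleLinkLogFlatness_proof (prover) · by planner
sources: doi:10.1007/978-1-4612-0793-1, doi:10.1070/im1973v007n02abeh001941, doi:10.2307/2661356
[support] card P3/P4 at one link, the geometric-mean (Mahler-measure) form: ∃ c ≥ 0, ∀ L U m₀ e g₀,
‖det D_W(U[e ↦ g₀])‖ e^(−c) ≤ exp ∫ log ‖det D_W(U[e ↦ g])‖ dHaar(g) (exponential form, immune to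
the junk value log 0 = 0). A uniform Remez/Łojasiewicz inequality on the unit sphere of the same
finite-dimensional V (log|F| uniformly integrable over F ∈ V, ‖F‖∞ = 1); iterated over a link set R
it says the sea can neither peak nor, in geometric mean, vanish on a large-field region by more than
e^(c|R|), uniformly in β, m, L — and at β = 0 that quenched ≥ annealed − c per link. [difficulty: M] -/
@[route_item "route-QuantumFields-PauliWegnerSea"]
def SingleLinkLogFlatness : Prop :=
  open MeasureTheory Filter Literature.MathematicalPhysics.QuantumFieldTheory Literature.MathematicalPhysics.QuantumLattice Literature.Probability.LatticeModels in ∃ c : ℝ, 0 ≤ c ∧ ∀ (L : ℕ) [NeZero L] (U : GaugeConfig 4 L (Matrix.specialUnitaryGroup (Fin 3) ℂ)) (m₀ : ℝ) (e : Edge 4 L) (g₀ : Matrix.specialUnitaryGroup (Fin 3) ℂ), ‖(wilsonDirac (fundamentalRep (Fin 3)) (Function.update U e g₀) m₀ 1).det‖ * Real.exp (-c) ≤ Real.exp (∫ g, Real.log ‖(wilsonDirac (fundamentalRep (Fin 3)) (Function.update U e g) m₀ 1).det‖ ∂(haarProbability (Matrix.specialUnitaryGroup (Fin 3) ℂ)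))

-- `SingleLinkLogFlatness` holds: proved by `Summit.QuantumFields.QCD.Theorems.singleLinkLogFlatness_proof` (its module imports this route file, so no `_holds` link can be stated here).

/-- item stmt-QuantumFields-11517 · assembly · rank 1 · closed · proved by Summit.QuantumFields.QCD.Theorems.pauliWegnerSea_assembly_proof (prover) · by planner
sources: JaffeWitten2000, AizenmanEtAl2001, GoltermanShamir2003
[assembly] FibreCofactorDomination ∧ FMClosureUnquenched ∧ TiltedFlatness ∧ OneScaleTrajectory ∧
PhaseQuenchedFlavourDecay ∧ GluonicCompletion → QCD (the deciding theorem `closes` is the curried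
form, conclusion the sub-problem constant `_root_.QCD` of Summits/QuantumFields/QCD/Statement.lean). -/
@[route_item "route-QuantumFields-PauliWegnerSea"]
def Assembly : Prop :=
  FibreCofactorDomination ∧ FMClosureUnquenched ∧ TiltedFlatness ∧ OneScaleTrajectory ∧ PhaseQuenchedFlavourDecay ∧ GluonicCompletion → QCD

-- `Assembly` holds: proved by `Summit.QuantumFields.QCD.Theorems.pauliWegnerSea_assembly_proof` (its module imports this route file, so no `_holds` link can be stated here).

/-! D-0027 §2.1 — DECIDING THEOREM (planner-authored via `route open/edit --closes-file`; by planner-rrepair-QuantumFields-PauliWegnerSea-s-a877cb2d-0 2026-08-16T23:21:03Z):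
its hypotheses are this route's items and its conclusion the sub-problem Statement (glue_lint), and it elaborates with this file. -/

/-- DECIDING THEOREM after the statement re-type p117723 (`def QCDOf` gained the conjunct `reg.IsChiralAtZero`; route-repair
2026-08-16): the chirality at zero of the route's OWN regularisation is SUPPLIED by the trajectory crux
`ChiralOneScaleTrajectory` (its constructor pins `m_crit(k)` to the chiral line — where the mobility edge of `H_W` reaches
zero — and proves that the honest lattice gap closes as `m → 0⁺`) and CONSUMED by the completion crux
`ChiralGluonicCompletion` (the package now carries `reg.IsChiralAtZero`, so the completion keeps the given critical line:
no freedom, and no burden, to shift the flavour-blind offset). Otherwise pure logic as in revs 0–4: for `N_f ∈ {2,3}`,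
`FMClosureUnquenched` fed `FibreCofactorDomination`, `TiltedFlatness` and the one-scale input gives clause (ii),
`PhaseQuenchedFlavourDecay` the flavour-charged phase-quenched gap, and `QCD = QCDOf 2 ∧ QCDOf 3`. (The rev-0 six-item
`closes` over `OneScaleTrajectory`/`GluonicCompletion` still elaborates — `GluonicCompletion` concludes `QCDOf N_f` by
name — but it hid the new conjunct inside the shared crux; `Theorems/PauliWegnerSeaAssembly.lean`, which applied it, is
to be re-landed with that eight-line proof inlined: replacement attached as evidence on stmt-QuantumFields-11517.) -/
@[closes "route-QuantumFields-PauliWegnerSea"] theorem closes (h₁ : FibreCofactorDomination) (h₂ : FMClosureUnquenched) (h₃ : TiltedFlatness)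
    (h₄ : ChiralOneScaleTrajectory) (h₅ : PhaseQuenchedFlavourDecay) (h₆ : ChiralGluonicCompletion) : QCD := by
  have key : ∀ Nf : ℕ, Nf = 2 ∨ Nf = 3 → QCDOf Nf := by
    intro Nf hNf
    obtain ⟨reg, hMS, hCh, hAS, h⟩ := h₄ Nf hNf
    refine h₆ Nf hNf ⟨reg, hMS, hCh, hAS, fun m hm => ?_⟩
    obtain ⟨hi, hin, hiii, hiv⟩ := h m hm
    have hii := h₂ h₁ h₃ Nf reg m hm hin
    exact ⟨⟨hi, hii, hiii, hiv⟩, h₅ Nf reg m hm hii⟩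
  exact ⟨key 2 (Or.inl rfl), key 3 (Or.inr rfl)⟩

end Summit.QuantumFields.QCD.Theses.PauliWegnerSea
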